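import Summits.ValiantsHypothesis.ValiantsHypothesis.Theorems.SymPencilSingSixClassificationPerpPlanes
import Summits.ValiantsHypothesis.ValiantsHypothesis.Theorems.SymPencilPerFourCrossFilter
import Summits.ValiantsHypothesis.ValiantsHypothesis.Theorems.SymPencilPerFourExoticNoSixSquares
import Mathlib.Algebra.Module.Submodule.Union
import Mathlib.Algebra.CharZero.Infinite

/-!
# Crux workfile `SdcSuperquadratic` — line `sing_six_classification` (val-idea-18 g3/g4, lens cascade; rev 3.1 — SORRY-FREE IN THE TREE: THEOREM A (T6′) and LIST both PROVED, on top of the PORTED parts 1–6)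

**Rev 3.1 layout (size cap).**  The monolithic sorry-free rev 3.0 (248 133 B; evidence parts 1/2 + 2/2 on
stmt-ValiantsHypothesis-5674, whole in the ideator pub `files/rev30/`) exceeds the 200 000-B cap of a crux
workfile.  This tree copy therefore IMPORTS val-width-5674-w2 g0′'s PORT of its own first half —
`Theorems/SymPencilSingSixClassification{Defs,Transport,Cases,CaseGraph,Absorb,PerpPlanes}.lean`
(p628115, p629196, p629617, p630341, p630881, part 6; ONE namespace
`Summit.ValiantsHypothesis.ValiantsHypothesis.Theorems.SymPencilSingSixClassification`, opened below) — and
DROPS the 122 declarations those parts contain (byte-identical statements; generator `dev/mkslim.py`,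
attached as evidence), keeping the other 120 (toric triples, leaf 1, the leaf-2 compositions, leaf 5 =
5-T/5a/5b, Theorem A, LIST).  Farm: rc 0, sorries 0; that the remaining half elaborates unchanged on top of
the ported parts is also an integration check of the port.  When parts 7–10 land (and are importable),
re-running the generator against them shrinks this file further; until then a later part that re-declares
one of the 120 kept names makes a RE-elaboration of this file ambiguous (drop the duplicate then).  The
companion `Lines/sing_six_classification_leaf5b.lean` (rev 3.0, 5b alone over `…Defs`) stays as the
port-ready form of leaf 5b.

SKELETON of the cascade «SING-SIX CLASSIFICATION» (memo `Cruxes/SdcSuperquadratic/SING-SIX-CLASSIFICATION.md`):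

* **T6′ = THEOREM A** (`sixDim_classification`, PROVED here without hypotheses and without `sorry`;
  composition `sixDim_classification_of`).  Over a field of characteristic `0`, every `6`-dimensional
  linear `W ⊆ Sing Z(per₄)` (all `3 × 3` subpermanents vanish on `W`) lies in a cross, or has two
  identically-zero rows, or two identically-zero columns, or is — up to `S₄ × S₄` — one of the two
  one-zero-row exotic families `V_λ = row a ⊕ K(αE_{bc}+βE_{bc'}) ⊕ K(αE_{b'c}−βE_{b'c'})` (`αβ ≠ 0`,
  val-width-5674-p1's `SymPencilPerFourSixDimExotic`) and `V^gr = row a ⊕ K(E_{bc}+c₀E_{b'c}) ⊕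
  K(E_{bc'}−c₀E_{b'c'})` (`c₀ ≠ 0`, new), or the transpose of one of them.
* **LIST** (`sixDim_perDir_list_of`).  If moreover the `s²`-coefficient of `per₄ (u + s y)` is, for
  every `y ∈ W`, a combination of `≤ 6` squares of linear forms in `u` (necessary for the joint
  six-square family of the size-`27` cell `(10, 6, 6)`), then `W` is, up to `S₄ × S₄ × ⟨ᵀ⟩`, one of the
  THREE coordinate spaces `V× = X_{lc} ∩ {one arm cell = 0}`, `W_col = rows{p,q} × (three columns)`,
  `W₂ = row p ⊕ (row q inside a coordinate plane)` — exactly the three rank-`≤ 6` classes of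
  val-width-5674-w2's coordinate census (`PENCIL-CROSS-27.md`), of which `V×` (p611870 + transport) and
  `W_col` (p617320 + p617764) are killed in Lean and `W₂` is paper-killed (rev 6).

The `stub_*` theorems are the cascade's leaves (each a routine case analysis proved ON PAPER in
the memo, §§2–5, with exact sanity checks `sing_six_classification_checks.py` (evidence on stmt-5674));
the compositions are kernel-checked here.  Rev 2 (g4, price P1 of val-idea-crit-5 VERDICT #5 /
R194 (a)): leaf 2 (`stub_zeroLineResidue`, L) is no longer a stub but the derived theorem
`zeroLineResidue`, assembled from THIRTEEN typed second-level stubs (polarisation PROVED; perm-orthogonal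
pairs; kernel-plane rulings; `S(B)`; Lemma Φ; product / graph absorption; the three `n_r = 4` cases;
`max n_r = 3`; toric structure + toric triple (shapes C1–C3′); symmetry transport) by the sorry-free
compositions `pureCore_of`, `caseFour_of`, `residueNorm_of`, `zeroLineResidue_of` — see the section
«Leaf 2» below.  Rev 2.1 (g4): the three S-sized residue stubs are PROVED in this file —
`permOrthPairs` (§3.3), `toricStructure` (§3.8, via the envelope `toricEnvelope W ⊇ W` of dimension
`≤ n₁ + n₂ + n₃`), `transport` (row-permutation / transposition linear equivalences `rowPermL`,
`transposeL`; `Sing3`, `finrank` and `Concl` transported) — and revs 2.2/2.3 prove ALL FOUR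
`W`-level CASES: `casePure_of : PureCore → CasePure`, `caseProduct_of : ProductAbsorb → CaseProduct`,
`caseGraph_of : GraphAbsorb → CaseGraph` (linear section `g` of `row_{ρ1}`, explicit generators of
`K_r`, the `t¹`-coefficient of `Sing3` along `g u + t k`, absorption) and `caseThree_of : PerpPlanes →
CaseThree` (rank drop `permOrth_of_T3_on` on the hyperplane `A_r`, `K_r` and `K_t` pure,
`W = K_r ⊕ K_t`); rev 2.4 proves the ABSORPTION MASTER LEMMA `T3_absorb_all` (if `T3 (u, b, χ u) = 0`
for all `u`, `χ` linear, then `T3 (u, b, χ u') = 0` for all `u, u'` — the scalar `⟨z, T3 (u, b, χ u')⟩`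
is symmetric in `(z, u)` and alternating in `(u, u')`, hence `0` in characteristic `≠ 2`), and from it
`productAbsorb` (§3.5 / C12, via the coordinate transport `T3_perm`), `graphAbsorb_of : ProductAbsorb →
GraphAbsorb` (C13) and `pureCore : PureCore` DIRECTLY (every `b ∈ B` is perm-orthogonal to `φ u`, and
the perm-orthogonal space of a nonzero vector is a line) — which retires `stub_sbShape` and
`stub_lemmaPhi` (the route `pureCore_of : SBShape → LemmaPhi → PureCore` stays proved but unused);
rev 2.5 proves the last two tools, `perpPlanes : PermOrthPairs → PerpPlanes` (§3.3: a finite-union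
lemma over the pieces of `Q_jc`, then the GRAPH / PRODUCT rulings inside `E_jc` by dimension) and
`toricTriple : PermOrthPairs → ToricTriple` (§3.8 WITHOUT `SBShape`: the KERNEL PAIR lemma `smallKer`
— the symmetric zero-diagonal matrices killing a `2`-plane form a line — gives every `a₃ ∈ A₃` a
perpendicular partner in `A₂`, so `A₃` sits on one coordinate pair, and a coordinate vector in `A₃`
pins everything, `toric_caseI`).  So LEAF 2 (`zeroLineResidue`, rev 1's `stub_zeroLineResidue`
VERBATIM) is PROVED WITHOUT `sorry`; and rev 2.6 proves LEAF 1 (`zeroLine`, rev 1's `stub_zeroLine`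
VERBATIM): Part A (`support_of_subperm_vanish`, p615473) pointwise, the finite-union lemma puts `W`
inside ONE of the `42` pattern subspaces (`piece`), and a proper anti-block is `anti_case` — the
subpermanents `per(P)·q`, `per(Q)·p` vanish (`T3_explicit`), polarisation along `x ± x₀` kills
`per(P)` or `Q` (`quad_kill`, characteristic `≠ 2`), and a totally isotropic subspace of
`p₁₁p₂₂ + p₁₂p₂₁` has dimension `≤ 2` (`iso_le_two`), so `dim W ≤ 4`.  Hence THEOREM A = T6′
(`sixDim_classification`) is PROVED in this file WITHOUT `sorry` and without hypotheses
(`#print axioms`: `propext, Classical.choice, Quot.sound`).  Rev 2.7: LIST leaves 3 and 4 are now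
TREE THEOREMS of val-width-5674-w2 g0′ — `Theorems.SymPencilPerFourExoticNoSixSquares.stub_exoticNoSixSquares`
(via `SymPencilPerFourExoticElemRankEight`, p626744: the exotic elements have Hessian rank `8`) and
`Theorems.SymPencilPerFourCrossFilter.stub_crossFilter` (p627105, via `SymPencilPerFourCrossKronecker`
p625552: the Kronecker form on a cross) — stated there VERBATIM with the predicates unfolded and
cited here BY NAME (`exoticNoSixSquares`, `crossFilter`; the `def`s unfold by `rfl`).  Rev 2.8:
LIST leaf 5 `twoLineFilter` is SPLIT and two thirds PROVED — symmetry transport (5-T: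
`perDirSix_map_of_eval`, `twoRowConcl_of_rowPerm`, `twoRowConclT_of_transpose`) and the Hessian
reduction (5a `twoRowDegenerate`: `PerDirSix` on two live rows ⇒ `P(y₀,y₁)` singular, i.e.
`∃ v ≠ 0, T3 v y₀ y₁ ≡ 0`, via test points, a common-kernel vector of the six functionals on the
`8`-dimensional block and polarisation).  **Rev 3.0 (g4): the last stub, the algebraic classification
5b (`twoRowClassify`: `6`-dim `W` on rows `0,1` with `P(y₀,y₁)` singular on `W` ⇒ `W_col` or `W₂`;
memo §5.3), is PROVED** — `TPDegenerate ⇒ Δ = 0` by the written-out adjugate of the `4 × 4` pencil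
matrix (`ΔP_eq_zero_of_tpDegenerate`; `Δ` = the Cayley form `Δ6` in the six pair permanents), the
`t → 0` limit by a fifth finite difference (`ΔP_limit`), the coordinate-plane lemma
(`triples_zero_of_ΔP`), the driver `twoRowClassify_of` (case split on the two row projections,
rank bookkeeping `fibre_aux`, union lemma, column / row transports), the graph case `caseTopNorm`
(fibre identities on the basis `(1,1,1,0),(1,2,1,0),(1,1,2,0),(1,1,0,1)`) and the hyperplane case
`caseHyp` (coordinate sub-case by three test families and the union lemma; non-coordinate sub-case by
a normal functional, a vector with no zero coordinate, a pivot transport and five explicit test points,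
`noncoord_pivot3`) — so THE WHOLE FILE IS `sorry`-FREE: `sixDim_perDir_list` (LIST) and
`sixDim_classification` (THEOREM A) depend only on `propext, Classical.choice, Quot.sound`
(`#print axioms`, farm).  What this gives the 5674 programme: the classification half of the
size-`27` cell `(10,6,6)` is a theorem; its kill still needs w2's joint-family step for `W₂`
(paper, `PENCIL-CROSS-27.md` rev 6) in Lean and the port of this file under `Theorems/` (R223 (a),
in progress by val-width-5674-w2).  Nothing here is a lower bound: `27 ≤ sdc(per₄) ≤ 29`
is unchanged, stmt-5674 `SdcSuperquadratic` stays open, `VP ≠ VNP` is not moved, and no summit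
statement is proved by this seat.  The `def`s below are support-pattern predicates (inline them when
landing a leaf under `Theorems/`). [folklore]
-/

noncomputable section

set_option linter.dupNamespace false
set_option linter.unusedVariables false
set_option linter.unusedSectionVars false

namespace Summit.ValiantsHypothesis.ValiantsHypothesis.Cruxes.SdcSuperquadratic.SingSixClassification

open Summit.ValiantsHypothesis.ValiantsHypothesis.Theorems.SymPencilSingSixClassification

open MvPolynomial Module
open Literature.Computability.AlgebraicComplexity

variable {K : Type*} [Field K]

/-! ## The leaves — ALL PROVED as of rev 3.0 (leaf 2 is split further below; leaves 3–4 are cited tree theorems; leaf 5 is split in section «Leaf 5») -/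

/-! ## Leaf 2 — the one-zero-line residue: SECOND-LEVEL SPLIT (rev 2/2.1, val-idea-18 g4; price P1 of val-idea-crit-5 VERDICT #5 / R194 (a))

The `L`-sized leaf `stub_zeroLineResidue` of rev 1 is now the DERIVED theorem `zeroLineResidue`
(sorry-free composition) of the typed cascade below.  Normal form: `NormSix W` = `W` singular,
`6`-dimensional, row `0` identically zero; the three live rows are addressed through a permutation `ρ`
of `Fin 4` with `ρ 0 = 0` (`r, s, t = ρ 1, ρ 2, ρ 3`); `A_i = W.map (rowL i)` (row space, `n_i` its
dimension), `K_r = W ⊓ ker (rowL r)` (kernel plane).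

TREE (memo §3; every `stub_*` is ONE leaf; sizes are Lean guesses S ≈ ½ day, M ≈ 1–2 days, L ≈ 3+ days):
* `zeroLineResidue_of : Transport → CaseFour → CaseThree → ToricStructure → ToricTriple → leaf 2`
  (PROVED: the trichotomy `some n_r = 4 ∨ (all ≤ 3, some = 3) ∨ all n_r ≤ 2` and the toric glue);
* `caseFour_of : PerpPlanes → CasePure → CaseProduct → CaseGraph → CaseFour`
  (PROVED: `dim K_r = 2` by rank–nullity, POLARISATION §3.1 (`polar`, PROVED) makes every element of
  `K_r` a perm-orthogonal pair of rows, and the four kernel-plane types of `PerpPlanes` are dispatched,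
  the second pure type through `ρ ∘ (2 3)`);
* `pureCore_of : SBShape → LemmaPhi → PureCore` (PROVED, unused since rev 2.4) and `pureCore : PureCore`
  (PROVED rev 2.4 from the absorption master lemma `T3_absorb_all` / `permOrth_absorb`);
* TOOLS (self-contained algebra over `K⁴`, no `W`): `permOrthPairs` (§3.3, PROVED rev 2.1),
  `productAbsorb` (§3.5 / C12, PROVED rev 2.4: transport `T3_perm` to `j = 0, c = 1` + a `16`-unknown
  linear system), `graphAbsorb_of : ProductAbsorb → GraphAbsorb` (C13, PROVED rev 2.4: `χ ± e φ` are
  absorbed by `e_j`, `e_c`), `perpPlanes : PermOrthPairs → PerpPlanes` (§3.3 rulings + covering,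
  PROVED rev 2.5), `toricTriple : PermOrthPairs → ToricTriple` (§3.8, PROVED rev 2.5 by the kernel-pair
  lemma `smallKer` + `coordPair_of_cover` + `toric_caseI`; no `SBShape` — `SBShape`, `LemmaPhi` remain
  as `def`s only);
* CASES (`W`-level; each ≤ one page on paper GIVEN its tool, which it takes as hypothesis):
  `casePure_of : PureCore → CasePure` (§3.6 (i), PROVED rev 2.2), `caseProduct_of : ProductAbsorb →
  CaseProduct` (§3.6 (ii), PROVED rev 2.3), `caseGraph_of : GraphAbsorb → CaseGraph` (§3.6 (iii),
  PROVED rev 2.3), `caseThree_of : PerpPlanes → CaseThree` (§3.7, PROVED rev 2.3 via the rank drop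
  `permOrth_of_T3_on` and `kerPlane_pure_of_three`); `toricStructure` (§3.8, linear algebra) and
  `transport` (`S₄ × S₄ × ⟨ᵀ⟩` transport to the normal form) are PROVED (rev 2.1).
REMAINING residue stubs: NONE (rev 2.5) — leaf 2 is closed; leaf 1 is closed too (rev 2.6, section «Leaf 1»
below), so THEOREM A `sixDim_classification` is sorry-free; LIST leaves 3–4 are tree theorems (w2, rev 2.7);
leaf 5 is split and PROVED (rev 2.8: 5-T, 5a; rev 3.0: 5b `twoRowClassify`) — the skeleton has NO open stub (rev 3.0).
Conventions: `pairPerm v w p q = v_p w_q + v_q w_p` (the memo's `m_{pq}(v,w)`), `T3 u v w l` = the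
`3 × 3` permanent of the rows `u, v, w` off column `l` (`= (P(v,w)u)_l`; symmetric, trilinear —
PROVED), `PermOrth v w` = `v ⊥ w`.  The memo's COMPLEMENTARY arrangement `P(v,w)_{ab} = m_{{a,b}ᶜ}(v,w)`
is spelled out where it matters (`SBShape`, `LemmaPhi`).  Exact sanity checks of the four freshly
typed tool statements in exactly these conventions: `leaf2_stub_checks.py` (evidence on stmt-5674;
C12′ ProductAbsorb incl. `αβ = 0`, C13′ GraphAbsorb, 3.2′ SBShape on 655 random/sparse planes + all
shapes, 3.4′ LemmaPhi for shapes 0/C1/C2/C3/C3′: 4/4 PASS).  [folklore] -/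

/-! ### Notation for the residue cascade -/

/-! ### Proved basics: `T3` is the subpermanent; symmetric, trilinear; polarisation -/

/-! ### Tool statements (self-contained linear algebra over `K⁴`; no `W`) -/

/-! ### Case statements (`W`-level; `r, s, t = ρ 1, ρ 2, ρ 3`, `ρ 0 = 0` the zero row) -/

/-! ### The residue cascade (rev 2.5: no stubs left — `permOrthPairs`, `transport` are proved here;
`toricStructure`, the tools and the four CASES further below) -/

/-! #### Symmetry transport — PROVED (rev 2.1; was `stub_transport`) -/

/-! ### Kernel-checked compositions of the residue cascade -/

omit [Field K] in
theorem fin4_cases (i : Fin 4) : i = 0 ∨ i = 1 ∨ i = 2 ∨ i = 3 := by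
  fin_cases i <;> simp

/-! #### Helpers for the `n_r = 4` cases (rev 2.3) -/

omit [Field K] in

/-! #### Helpers for the case `max n_r = 3` (rev 2.3) -/

/-! #### Coordinate transport and the absorption tools (rev 2.4) -/

/-! #### Absorption: the master lemma (rev 2.4) -/

/-! #### Perpendicular planes: covering by the pieces `E_{jc}` and the two rulings of `Q_jc` (rev 2.5) -/

/-! #### Toric triples (rev 2.5): kernel pairs, perpendicular partners, one coordinate vector -/

/-- Vectors supported on the columns `{j, c}`. -/
def E1 (j c : Fin 4) : Submodule K (Fin 4 → K) where
  carrier := {u | ∀ i, i ≠ j → i ≠ c → u i = 0}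
  add_mem' := by
    intro a b ha hb i hij hic
    simp [ha i hij hic, hb i hij hic]
  zero_mem' := by
    intro i _ _
    simp
  smul_mem' := by
    intro r a ha i hij hic
    simp [ha i hij hic]

theorem mem_E1 {j c : Fin 4} {u : Fin 4 → K} :
    u ∈ E1 (K := K) j c ↔ ∀ i, i ≠ j → i ≠ c → u i = 0 := Iff.rfl

/-- A subspace all of whose vectors are supported on (varying) pairs is supported on ONE pair
(again `Submodule.exists_forall_notMem_of_forall_ne_top`). -/
theorem coordPair_of_cover [CharZero K] (A : Submodule K (Fin 4 → K))
    (h : ∀ a ∈ A, ∃ j c : Fin 4, j ≠ c ∧ ∀ i, i ≠ j → i ≠ c → a i = 0) :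
    ∃ j c : Fin 4, j ≠ c ∧ ∀ a ∈ A, ∀ i, i ≠ j → i ≠ c → a i = 0 := by
  by_contra hnone
  have hcov : ∀ j c : Fin 4, ¬ ∀ a ∈ A, ∀ i, i ≠ j → i ≠ c → a i = 0 := by
    intro j c hall
    by_cases hjc : j = c
    · obtain ⟨c', hc'⟩ := exists_ne j
      exact hnone ⟨j, c', hc'.symm, fun a ha i hij _ => hall a ha i hij (by rw [← hjc]; exact hij)⟩
    · exact hnone ⟨j, c, hjc, hall⟩
  have hne : ∀ jc : Fin 4 × Fin 4, (E1 (K := K) jc.1 jc.2).comap A.subtype ≠ ⊤ := by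
    intro jc hjc
    exact hcov jc.1 jc.2 fun a ha => by
      have hmem : (⟨a, ha⟩ : A) ∈ (E1 (K := K) jc.1 jc.2).comap A.subtype := by
        rw [hjc]; exact Submodule.mem_top
      exact hmem
  obtain ⟨x, hx⟩ := Submodule.exists_forall_notMem_of_forall_ne_top
    (fun jc : Fin 4 × Fin 4 => (E1 (K := K) jc.1 jc.2).comap A.subtype) hne
  obtain ⟨j, c, _, hsup⟩ := h x x.2
  exact hx (j, c) hsup

/-- In a `2`-dimensional `A`, two jointly injective coordinates are jointly surjective. -/
theorem exists_of_inj2 {A : Submodule K (Fin 4 → K)} (hA : finrank K A = 2) {p l : Fin 4}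
    (hinj : ∀ a ∈ A, a p = 0 → a l = 0 → a = 0) (c d : K) : ∃ a ∈ A, a p = c ∧ a l = d := by
  obtain ⟨π, hπ_def⟩ : ∃ π : A →ₗ[K] K × K, π =
      ((LinearMap.proj p : (Fin 4 → K) →ₗ[K] K).comp A.subtype).prod
        ((LinearMap.proj l : (Fin 4 → K) →ₗ[K] K).comp A.subtype) := ⟨_, rfl⟩
  have hπ : ∀ x : A, π x = ((x : Fin 4 → K) p, (x : Fin 4 → K) l) := fun x => by rw [hπ_def]; rfl
  have hπinj : Function.Injective π := by
    intro x y hxy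
    rw [hπ, hπ, Prod.mk.injEq] at hxy
    apply Subtype.ext
    have := hinj ((x : Fin 4 → K) - y) (A.sub_mem x.2 y.2)
      (by rw [Pi.sub_apply, hxy.1, sub_self]) (by rw [Pi.sub_apply, hxy.2, sub_self])
    exact sub_eq_zero.mp this
  have hπsurj : Function.Surjective π := by
    refine (LinearMap.injective_iff_surjective_of_finrank_eq_finrank ?_).mp hπinj
    rw [hA]; simp
  obtain ⟨x, hx⟩ := hπsurj (c, d)
  rw [hπ, Prod.mk.injEq] at hx
  exact ⟨x, x.2, hx.1, hx.2⟩

/-- A linear functional on a `2`-dimensional space has a nonzero kernel vector. -/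
theorem exists_ne_zero_ker {A : Submodule K (Fin 4 → K)} (hA : finrank K A = 2)
    (f : A →ₗ[K] K) : ∃ a : A, a ≠ 0 ∧ f a = 0 := by
  have hrn := LinearMap.finrank_range_add_finrank_ker f
  have hr : finrank K (LinearMap.range f) ≤ 1 := by
    have := Submodule.finrank_le (LinearMap.range f)
    simpa using this
  have hk : LinearMap.ker f ≠ ⊥ := by
    intro hbot
    rw [hbot, hA] at hrn
    simp at hrn
    omega
  obtain ⟨a, ha, hne⟩ := (Submodule.ne_bot_iff _).mp hk
  exact ⟨a, hne, LinearMap.mem_ker.mp ha⟩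

/-- Two normalised vectors `x = (…1_p…0_q…)`, `y = (…0_p…1_q…)` in a `2`-dimensional `A`. -/
theorem exists_normalized {A : Submodule K (Fin 4 → K)} (hA : finrank K A = 2) :
    ∃ (p q : Fin 4) (x y : Fin 4 → K), p ≠ q ∧ x ∈ A ∧ y ∈ A ∧
      x p = 1 ∧ x q = 0 ∧ y p = 0 ∧ y q = 1 := by
  obtain ⟨b₁, hb₁ne, -⟩ := exists_ne_zero_ker hA 0
  obtain ⟨p, hp⟩ : ∃ p, (b₁ : Fin 4 → K) p ≠ 0 := by
    by_contra h
    push Not at h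
    exact hb₁ne (Subtype.ext (funext h))
  obtain ⟨b₂, hb₂ne, hb₂p⟩ :=
    exists_ne_zero_ker hA ((LinearMap.proj p : (Fin 4 → K) →ₗ[K] K).comp A.subtype)
  have hb₂p' : (b₂ : Fin 4 → K) p = 0 := hb₂p
  obtain ⟨q, hq⟩ : ∃ q, (b₂ : Fin 4 → K) q ≠ 0 := by
    by_contra h
    push Not at h
    exact hb₂ne (Subtype.ext (funext h))
  have hpq : p ≠ q := by rintro rfl; exact hq hb₂p'
  refine ⟨p, q, ((b₁ : Fin 4 → K) p)⁻¹ • (b₁ : Fin 4 → K) -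
      (((b₁ : Fin 4 → K) p)⁻¹ * (b₁ : Fin 4 → K) q * ((b₂ : Fin 4 → K) q)⁻¹) • (b₂ : Fin 4 → K),
    ((b₂ : Fin 4 → K) q)⁻¹ • (b₂ : Fin 4 → K), hpq, ?_, ?_, ?_, ?_, ?_, ?_⟩
  · exact A.sub_mem (A.smul_mem _ b₁.2) (A.smul_mem _ b₂.2)
  · exact A.smul_mem _ b₂.2
  · simp [hb₂p', hp]
  · simp [hq]
  · simp [hb₂p']
  · simp [hq]

/-- CASE I of the toric triple: a coordinate vector `e_l ∈ A₃`.  Then `e_l ∈ A₂, A₁` too (the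
coordinates `(p, l)` are injective, hence surjective, on the partner plane), all `2 × 2` permanents
off `l` vanish across the three planes, and one vector `x₃ ∈ A₃` with `x₃(l) = 0` pins a second
column `m`: `2 x₃(i) = 0` for `i ∉ {l, m}` (characteristic `≠ 2`), whence everything vanishes off
`{l, m}`. -/
theorem toric_caseI [CharZero K] {A₁ A₂ A₃ : Submodule K (Fin 4 → K)}
    (hA₁ : finrank K A₁ = 2) (hA₂ : finrank K A₂ = 2) (hA₃ : finrank K A₃ = 2)
    (hT : ∀ a₁ ∈ A₁, ∀ a₂ ∈ A₂, ∀ a₃ ∈ A₃, ∀ l, T3 a₁ a₂ a₃ l = 0) {l : Fin 4}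
    (hl3 : (Pi.single l 1 : Fin 4 → K) ∈ A₃) :
    ∃ p q : Fin 4, p ≠ q ∧ (∀ a ∈ A₁, a p = 0 ∧ a q = 0) ∧ (∀ a ∈ A₂, a p = 0 ∧ a q = 0) ∧
      (∀ a ∈ A₃, a p = 0 ∧ a q = 0) := by
  have H3 : ∀ a₁ ∈ A₁, ∀ a₂ ∈ A₂, ∀ p q, p ≠ q → p ≠ l → q ≠ l → pairPerm a₁ a₂ p q = 0 :=
    fun a₁ h₁ a₂ h₂ p q hpq hpl hql =>
      pairPerm_of_T3_single (fun l' => hT a₁ h₁ a₂ h₂ _ hl3 l') hpq hpl hql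
  -- from the permanents off `l` between `B` and `C`: `e_l ∈ C`
  have step : ∀ {B C : Submodule K (Fin 4 → K)}, finrank K B = 2 → finrank K C = 2 →
      (∀ b ∈ B, ∀ c ∈ C, ∀ p q, p ≠ q → p ≠ l → q ≠ l → pairPerm b c p q = 0) →
      (Pi.single l 1 : Fin 4 → K) ∈ C := by
    intro B C hB hC hBC
    obtain ⟨b, hbne, hbl⟩ :=
      exists_ne_zero_ker hB ((LinearMap.proj l : (Fin 4 → K) →ₗ[K] K).comp B.subtype)
    have hbl' : (b : Fin 4 → K) l = 0 := hbl
    obtain ⟨p, hp⟩ : ∃ p, (b : Fin 4 → K) p ≠ 0 := by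
      by_contra h
      push Not at h
      exact hbne (Subtype.ext (funext h))
    have hpl : p ≠ l := by rintro rfl; exact hp hbl'
    have hinj : ∀ c ∈ C, c p = 0 → c l = 0 → c = 0 := by
      intro c hc hcp hcl
      funext i
      by_cases hip : i = p
      · rw [hip]; exact hcp
      by_cases hil : i = l
      · rw [hil]; exact hcl
      have h := hBC b b.2 c hc p i (Ne.symm hip) hpl hil
      simp only [pairPerm, hcp, mul_zero, add_zero] at h
      exact (mul_eq_zero.mp h).resolve_left hp
    obtain ⟨e, heC, hep, hel⟩ := exists_of_inj2 hC hinj 0 1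
    have he : e = Pi.single l 1 := by
      funext i
      by_cases hil : i = l
      · rw [hil, hel]; simp
      by_cases hip : i = p
      · rw [hip, hep]; simp [hpl]
      have h := hBC b b.2 e heC p i (Ne.symm hip) hpl hil
      simp only [pairPerm, hep, mul_zero, add_zero] at h
      rw [(mul_eq_zero.mp h).resolve_left hp]
      simp [hil]
    rw [← he]
    exact heC
  have hl2 : (Pi.single l 1 : Fin 4 → K) ∈ A₂ := step hA₁ hA₂ H3
  have H2 : ∀ a₁ ∈ A₁, ∀ a₃ ∈ A₃, ∀ p q, p ≠ q → p ≠ l → q ≠ l → pairPerm a₁ a₃ p q = 0 :=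
    fun a₁ h₁ a₃ h₃ p q hpq hpl hql =>
      pairPerm_of_T3_single
        (fun l' => by rw [← T3_swap₂₃]; exact hT a₁ h₁ _ hl2 a₃ h₃ l') hpq hpl hql
  have hl1 : (Pi.single l 1 : Fin 4 → K) ∈ A₁ :=
    step hA₂ hA₁ fun b hb c hc p q hpq hpl hql => by
      rw [pairPerm_comm]; exact H3 c hc b hb p q hpq hpl hql
  have H1 : ∀ a₂ ∈ A₂, ∀ a₃ ∈ A₃, ∀ p q, p ≠ q → p ≠ l → q ≠ l → pairPerm a₂ a₃ p q = 0 :=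
    fun a₂ h₂ a₃ h₃ p q hpq hpl hql =>
      pairPerm_of_T3_single
        (fun l' => by rw [T3_swap₁₃, T3_swap₂₃]; exact hT _ hl1 a₂ h₂ a₃ h₃ l') hpq hpl hql
  -- a vector `x₃ ∈ A₃` with `x₃ l = 0`, and a column `m` with `x₃ m ≠ 0`
  obtain ⟨x₃, hx₃ne, hx₃l⟩ :=
    exists_ne_zero_ker hA₃ ((LinearMap.proj l : (Fin 4 → K) →ₗ[K] K).comp A₃.subtype)
  have hx₃l' : (x₃ : Fin 4 → K) l = 0 := hx₃l
  obtain ⟨m, hm⟩ : ∃ m, (x₃ : Fin 4 → K) m ≠ 0 := by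
    by_contra h
    push Not at h
    exact hx₃ne (Subtype.ext (funext h))
  have hml : m ≠ l := by rintro rfl; exact hm hx₃l'
  have hinj1 : ∀ a ∈ A₁, a m = 0 → a l = 0 → a = 0 := by
    intro a ha ham hal
    funext i
    by_cases him : i = m
    · rw [him]; exact ham
    by_cases hil : i = l
    · rw [hil]; exact hal
    have h := H2 a ha x₃ x₃.2 m i (Ne.symm him) hml hil
    simp only [pairPerm, ham, zero_mul, zero_add] at h
    exact (mul_eq_zero.mp h).resolve_right hm
  have hinj2 : ∀ a ∈ A₂, a m = 0 → a l = 0 → a = 0 := by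
    intro a ha ham hal
    funext i
    by_cases him : i = m
    · rw [him]; exact ham
    by_cases hil : i = l
    · rw [hil]; exact hal
    have h := H1 a ha x₃ x₃.2 m i (Ne.symm him) hml hil
    simp only [pairPerm, ham, zero_mul, zero_add] at h
    exact (mul_eq_zero.mp h).resolve_right hm
  obtain ⟨a₁, ha₁, ha₁m, -⟩ := exists_of_inj2 hA₁ hinj1 1 0
  obtain ⟨a₂, ha₂, ha₂m, -⟩ := exists_of_inj2 hA₂ hinj2 1 0
  -- `x₃` vanishes off `{l, m}` (characteristic `≠ 2`)
  have hx₃ : ∀ i, i ≠ l → i ≠ m → (x₃ : Fin 4 → K) i = 0 := by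
    intro i hil him
    have h1 := H2 a₁ ha₁ x₃ x₃.2 m i (Ne.symm him) hml hil
    have h2 := H1 a₂ ha₂ x₃ x₃.2 m i (Ne.symm him) hml hil
    have h12 := H3 a₁ ha₁ a₂ ha₂ m i (Ne.symm him) hml hil
    simp only [pairPerm, ha₁m, ha₂m, one_mul, mul_one] at h1 h2 h12
    have : (2 : K) * (x₃ : Fin 4 → K) i = 0 := by
      linear_combination h1 + h2 - (x₃ : Fin 4 → K) m * h12
    exact (mul_eq_zero.mp this).resolve_left two_ne_zero
  -- everything vanishes off `{l, m}`
  have hZ1 : ∀ a ∈ A₁, ∀ i, i ≠ l → i ≠ m → a i = 0 := by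
    intro a ha i hil him
    have h := H2 a ha x₃ x₃.2 m i (Ne.symm him) hml hil
    rw [pairPerm, hx₃ i hil him, mul_zero, zero_add] at h
    exact (mul_eq_zero.mp h).resolve_right hm
  have hZ2 : ∀ a ∈ A₂, ∀ i, i ≠ l → i ≠ m → a i = 0 := by
    intro a ha i hil him
    have h := H1 a ha x₃ x₃.2 m i (Ne.symm him) hml hil
    rw [pairPerm, hx₃ i hil him, mul_zero, zero_add] at h
    exact (mul_eq_zero.mp h).resolve_right hm
  have hZ3 : ∀ a ∈ A₃, ∀ i, i ≠ l → i ≠ m → a i = 0 := by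
    intro a ha i hil him
    have h := H2 a₁ ha₁ a ha m i (Ne.symm him) hml hil
    rw [pairPerm, ha₁m, hZ1 a₁ ha₁ i hil him, one_mul, zero_mul, add_zero] at h
    exact h
  -- the two remaining columns
  obtain ⟨γ, hγ0, hγ1⟩ := exists_perm_zero_one hml.symm
  have h2l : γ 2 ≠ l := by rw [← hγ0]; exact fun h => absurd (γ.injective h) (by decide)
  have h2m : γ 2 ≠ m := by rw [← hγ1]; exact fun h => absurd (γ.injective h) (by decide)
  have h3l : γ 3 ≠ l := by rw [← hγ0]; exact fun h => absurd (γ.injective h) (by decide)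
  have h3m : γ 3 ≠ m := by rw [← hγ1]; exact fun h => absurd (γ.injective h) (by decide)
  refine ⟨γ 2, γ 3, fun h => absurd (γ.injective h) (by decide), ?_, ?_, ?_⟩
  · exact fun a ha => ⟨hZ1 a ha _ h2l h2m, hZ1 a ha _ h3l h3m⟩
  · exact fun a ha => ⟨hZ2 a ha _ h2l h2m, hZ2 a ha _ h3l h3m⟩
  · exact fun a ha => ⟨hZ3 a ha _ h2l h2m, hZ3 a ha _ h3l h3m⟩

/-- **§3.8 TORIC TRIPLES — PROVED** (rev 2.5; was `stub_toricTriple`; no `SBShape`).  Normalise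
`x = (1_p, 0_q, …)`, `y = (0_p, 1_q, …)` in `A₁`; for `a₃ ∈ A₃` the functional
`a₂ ↦ m_{pq}(a₂, a₃)` on the plane `A₂` has a nonzero kernel vector, which by the KERNEL PAIR
lemma `smallKer` is a perpendicular partner of `a₃`; so (`PermOrthPairs`) every `a₃ ∈ A₃` is
supported on a pair, hence (`coordPair_of_cover`) `A₃` on ONE pair `{j, c}`, so `e_j ∈ A₃` and
CASE I (`toric_caseI`) concludes. -/
theorem toricTriple [CharZero K] (hPOP : PermOrthPairs K) : ToricTriple K := by
  intro A₁ A₂ A₃ hA₁ hA₂ hA₃ hT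
  obtain ⟨p, q, x, y, hpq, hxA, hyA, hxp, hxq, hyp, hyq⟩ := exists_normalized hA₁
  have hcover : ∀ a₃ ∈ A₃, ∃ j c : Fin 4, j ≠ c ∧ ∀ i, i ≠ j → i ≠ c → a₃ i = 0 := by
    intro a₃ ha₃
    obtain ⟨f, hf_def⟩ : ∃ f : A₂ →ₗ[K] K, f =
        a₃ q • ((LinearMap.proj p : (Fin 4 → K) →ₗ[K] K).comp A₂.subtype) +
          a₃ p • ((LinearMap.proj q : (Fin 4 → K) →ₗ[K] K).comp A₂.subtype) := ⟨_, rfl⟩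
    have hf : ∀ a : A₂, f a = pairPerm (a : Fin 4 → K) a₃ p q := fun a => by
      rw [hf_def]
      simp only [LinearMap.add_apply, LinearMap.smul_apply, LinearMap.comp_apply,
        Submodule.subtype_apply, LinearMap.proj_apply, smul_eq_mul, pairPerm]
      ring
    obtain ⟨a₂, ha₂ne, hfa₂⟩ := exists_ne_zero_ker hA₂ f
    rw [hf] at hfa₂
    have hperp : PermOrth (a₂ : Fin 4 → K) a₃ :=
      smallKer hpq (a₂ : Fin 4 → K) a₃ x y hxp hxq hyp hyq
        (fun l => hT x hxA a₂ a₂.2 a₃ ha₃ l) (fun l => hT y hyA a₂ a₂.2 a₃ ha₃ l) hfa₂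
    rcases hPOP (a₂ : Fin 4 → K) a₃ hperp with h0 | h0 | ⟨j, c, hjc, hsup⟩
    · exact absurd (Subtype.ext h0) ha₂ne
    · exact ⟨0, 1, by decide, fun i _ _ => by rw [h0]; rfl⟩
    · exact ⟨j, c, hjc, fun i hij hic => (hsup i hij hic).2⟩
  obtain ⟨j, c, hjc, hE⟩ := coordPair_of_cover A₃ hcover
  have hinj3 : ∀ a ∈ A₃, a j = 0 → a c = 0 → a = 0 := by
    intro a ha haj hac
    funext i
    by_cases hij : i = j
    · rw [hij]; exact haj
    by_cases hic : i = c
    · rw [hic]; exact hac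
    exact hE a ha i hij hic
  obtain ⟨ej, hejA, hej1, hej0⟩ := exists_of_inj2 hA₃ hinj3 1 0
  have hej : ej = Pi.single j 1 := by
    funext i
    by_cases hij : i = j
    · rw [hij, hej1]; simp
    by_cases hic : i = c
    · rw [hic, hej0]; simp [Ne.symm hjc]
    rw [hE ej hejA i hij hic]
    simp [hij]
  rw [hej] at hejA
  exact toric_caseI hA₁ hA₂ hA₃ hT hejA

/-! #### Leaf 1 (rev 2.6): the zero-line lemma — Part A + finite union + the anti-block count -/

/-- If `(P ± …)·(ℓ ± c) = 0` along `x ± x₀` with `c ≠ 0`, the quadratic `P` dies (char `≠ 2`). -/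
theorem quad_kill [CharZero K] {Px P0 B xab c : K} (hc : c ≠ 0) (e0 : Px * xab = 0) (p0 : P0 = 0)
    (ep : (Px + B + P0) * (xab + c) = 0) (em : (Px - B + P0) * (xab - c) = 0) : Px = 0 := by
  have h : 2 * c ^ 2 * Px = 0 := by
    linear_combination c * ep - c * em - xab * ep - xab * em + 2 * xab * e0 +
      2 * (xab ^ 2 - c ^ 2) * p0
  rcases mul_eq_zero.mp h with h | h
  · exact absurd (mul_eq_zero.mp h) (by simp [hc])
  · exact h

/-- Totally isotropic subspaces of the split form `v₀ v₃ + v₁ v₂` on `K⁴` have dimension `≤ 2`. -/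
theorem iso_le_two (V : Submodule K (Fin 4 → K)) (hV : ∀ v ∈ V, v 0 * v 3 + v 1 * v 2 = 0) :
    finrank K V ≤ 2 := by
  have hB : ∀ v ∈ V, ∀ w ∈ V, v 0 * w 3 + v 3 * w 0 + v 1 * w 2 + v 2 * w 1 = 0 := by
    intro v hv w hw
    have h := hV (v + w) (V.add_mem hv hw)
    simp only [Pi.add_apply] at h
    linear_combination h - hV v hv - hV w hw
  have key : ∀ a b : Fin 4, (∀ v ∈ V, v a = 0 → v b = 0 → v = 0) → finrank K V ≤ 2 := by
    intro a b hinj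
    obtain ⟨π, hπ_def⟩ : ∃ π : V →ₗ[K] K × K, π =
        ((LinearMap.proj a : (Fin 4 → K) →ₗ[K] K).comp V.subtype).prod
          ((LinearMap.proj b : (Fin 4 → K) →ₗ[K] K).comp V.subtype) := ⟨_, rfl⟩
    have hπ : ∀ x : V, π x = ((x : Fin 4 → K) a, (x : Fin 4 → K) b) := fun x => by
      rw [hπ_def]; rfl
    have hinj' : Function.Injective π := by
      intro x y hxy
      rw [hπ, hπ, Prod.mk.injEq] at hxy
      apply Subtype.ext
      have := hinj ((x : Fin 4 → K) - y) (V.sub_mem x.2 y.2)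
        (by rw [Pi.sub_apply, hxy.1, sub_self]) (by rw [Pi.sub_apply, hxy.2, sub_self])
      exact sub_eq_zero.mp this
    have := LinearMap.finrank_le_finrank_of_injective hinj'
    simpa using this
  by_cases h01 : ∀ v ∈ V, v 0 = 0 → v 1 = 0 → v = 0
  · exact key 0 1 h01
  by_cases h23 : ∀ v ∈ V, v 2 = 0 → v 3 = 0 → v = 0
  · exact key 2 3 h23
  push Not at h01 h23
  obtain ⟨p, hpV, hp0, hp1, hpne⟩ := h01
  obtain ⟨q, hqV, hq2, hq3, hqne⟩ := h23
  have rp : ∀ w ∈ V, p 3 * w 0 + p 2 * w 1 = 0 := fun w hw => by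
    have h := hB p hpV w hw
    rw [hp0, hp1] at h
    linear_combination h
  have rq : ∀ w ∈ V, q 0 * w 3 + q 1 * w 2 = 0 := fun w hw => by
    have h := hB q hqV w hw
    rw [hq2, hq3] at h
    linear_combination h
  have hp23 : p 2 ≠ 0 ∨ p 3 ≠ 0 := by
    by_contra h
    push Not at h
    exact hpne (funext fun i => by
      rcases fin4_cases i with rfl | rfl | rfl | rfl
      · exact hp0
      · exact hp1
      · exact h.1
      · exact h.2)
  have hq01 : q 0 ≠ 0 ∨ q 1 ≠ 0 := by
    by_contra h
    push Not at h
    exact hqne (funext fun i => by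
      rcases fin4_cases i with rfl | rfl | rfl | rfl
      · exact h.1
      · exact h.2
      · exact hq2
      · exact hq3)
  -- from `rp`: `w a' = 0 ⇒ w (other) = 0` on `{0,1}`; from `rq` likewise on `{2,3}`
  have hw01 : ∀ w ∈ V, (p 2 ≠ 0 → w 0 = 0 → w 1 = 0) ∧ (p 3 ≠ 0 → w 1 = 0 → w 0 = 0) := by
    intro w hw
    refine ⟨fun hp2 h0 => ?_, fun hp3 h1 => ?_⟩
    · have h := rp w hw
      rw [h0] at h
      have : p 2 * w 1 = 0 := by linear_combination h
      exact (mul_eq_zero.mp this).resolve_left hp2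
    · have h := rp w hw
      rw [h1] at h
      have : p 3 * w 0 = 0 := by linear_combination h
      exact (mul_eq_zero.mp this).resolve_left hp3
  have hw23 : ∀ w ∈ V, (q 0 ≠ 0 → w 2 = 0 → w 3 = 0) ∧ (q 1 ≠ 0 → w 3 = 0 → w 2 = 0) := by
    intro w hw
    refine ⟨fun hq0 h2 => ?_, fun hq1 h3 => ?_⟩
    · have h := rq w hw
      rw [h2] at h
      have : q 0 * w 3 = 0 := by linear_combination h
      exact (mul_eq_zero.mp this).resolve_left hq0
    · have h := rq w hw
      rw [h3] at h
      have : q 1 * w 2 = 0 := by linear_combination h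
      exact (mul_eq_zero.mp this).resolve_left hq1
  have fin : ∀ w : Fin 4 → K, w 0 = 0 → w 1 = 0 → w 2 = 0 → w 3 = 0 → w = 0 := by
    intro w h0 h1 h2 h3
    funext i
    rcases fin4_cases i with rfl | rfl | rfl | rfl
    · exact h0
    · exact h1
    · exact h2
    · exact h3
  rcases hp23 with hp2 | hp3 <;> rcases hq01 with hq0 | hq1
  · exact key 0 2 fun w hw h0 h2 =>
      fin w h0 ((hw01 w hw).1 hp2 h0) h2 ((hw23 w hw).1 hq0 h2)
  · exact key 0 3 fun w hw h0 h3 =>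
      fin w h0 ((hw01 w hw).1 hp2 h0) ((hw23 w hw).2 hq1 h3) h3
  · exact key 1 2 fun w hw h1 h2 =>
      fin w ((hw01 w hw).2 hp3 h1) h1 h2 ((hw23 w hw).1 hq0 h2)
  · exact key 1 3 fun w hw h1 h3 =>
      fin w ((hw01 w hw).2 hp3 h1) h1 ((hw23 w hw).2 hq1 h3) h3

/-- The `P`-block and `Q`-block coordinates of the normal anti-block. -/
def cP : Fin 4 → Fin 4 × Fin 4 := ![(0, 2), (0, 3), (1, 2), (1, 3)]
def cQ : Fin 4 → Fin 4 × Fin 4 := ![(2, 0), (2, 1), (3, 0), (3, 1)]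

def πP : (Fin 4 × Fin 4 → K) →ₗ[K] (Fin 4 → K) :=
  LinearMap.pi fun k => LinearMap.proj (cP k)
def πQ : (Fin 4 × Fin 4 → K) →ₗ[K] (Fin 4 → K) :=
  LinearMap.pi fun k => LinearMap.proj (cQ k)

@[simp] theorem πP_apply (x : Fin 4 × Fin 4 → K) (k : Fin 4) : πP (K := K) x k = x (cP k) := rfl
@[simp] theorem πQ_apply (x : Fin 4 × Fin 4 → K) (k : Fin 4) : πQ (K := K) x k = x (cQ k) := rfl
@[simp] theorem cP_0 : cP 0 = (0, 2) := rfl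
@[simp] theorem cP_1 : cP 1 = (0, 3) := rfl
@[simp] theorem cP_2 : cP 2 = (1, 2) := rfl
@[simp] theorem cP_3 : cP 3 = (1, 3) := rfl
@[simp] theorem cQ_0 : cQ 0 = (2, 0) := rfl
@[simp] theorem cQ_1 : cQ 1 = (2, 1) := rfl
@[simp] theorem cQ_2 : cQ 2 = (3, 0) := rfl
@[simp] theorem cQ_3 : cQ 3 = (3, 1) := rfl

/-- **ANTI-BLOCK in normal position.**  If `W ⊆ Sing` has `x (a, b) = 0` whenever
`[a ∈ {0,1}] = [b ∈ {0,1}]` (so `W` lives on `P = {0,1} × {2,3}` and `Q = {2,3} × {0,1}`), then row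
`0` or row `2` vanishes on `W`, or `dim W ≤ 4`: the subpermanents `per(P)·q`, `per(Q)·p` vanish, so
(along `x ± x₀`, characteristic `≠ 2`) `Q ≡ 0`, or `P ≡ 0`, or `per(P) ≡ per(Q) ≡ 0` on `W`, and a
totally isotropic plane of `p₁₁p₂₂ + p₁₂p₂₁` has dimension `≤ 2` (`iso_le_two`). -/
theorem anti_normal [CharZero K] {W : Submodule K (Fin 4 × Fin 4 → K)} (hS : Sing3 W)
    (h5 : 5 ≤ finrank K W)
    (hZ : ∀ x ∈ W, ∀ a b : Fin 4, ((a = 0 ∨ a = 1) ↔ (b = 0 ∨ b = 1)) → x (a, b) = 0) :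
    (∀ x ∈ W, ∀ j, x (0, j) = 0) ∨ (∀ x ∈ W, ∀ j, x (2, j) = 0) := by
  -- (A) per(P)·q = 0
  have hA : ∀ x ∈ W, ∀ a b : Fin 4, (a = 2 ∨ a = 3) → (b = 0 ∨ b = 1) →
      (x (0, 2) * x (1, 3) + x (0, 3) * x (1, 2)) * x (a, b) = 0 := by
    intro x hx a b ha hb
    have z := hZ x hx
    rcases ha with rfl | rfl <;> rcases hb with rfl | rfl
    · have t := T3_eq_zero_of_sing3 hS hx 0 1 2 (by decide) (by decide) (by decide) 1
      rw [(T3_explicit _ _ _).2.1] at t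
      simp only [row_apply, z 0 0 (by decide), z 1 0 (by decide), z 2 2 (by decide),
        z 2 3 (by decide)] at t
      linear_combination t
    · have t := T3_eq_zero_of_sing3 hS hx 0 1 2 (by decide) (by decide) (by decide) 0
      rw [(T3_explicit _ _ _).1] at t
      simp only [row_apply, z 0 1 (by decide), z 1 1 (by decide), z 2 2 (by decide),
        z 2 3 (by decide)] at t
      linear_combination t
    · have t := T3_eq_zero_of_sing3 hS hx 0 1 3 (by decide) (by decide) (by decide) 1
      rw [(T3_explicit _ _ _).2.1] at t
      simp only [row_apply, z 0 0 (by decide), z 1 0 (by decide), z 3 2 (by decide),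
        z 3 3 (by decide)] at t
      linear_combination t
    · have t := T3_eq_zero_of_sing3 hS hx 0 1 3 (by decide) (by decide) (by decide) 0
      rw [(T3_explicit _ _ _).1] at t
      simp only [row_apply, z 0 1 (by decide), z 1 1 (by decide), z 3 2 (by decide),
        z 3 3 (by decide)] at t
      linear_combination t
  -- (B) per(Q)·p = 0
  have hB : ∀ x ∈ W, ∀ a b : Fin 4, (a = 0 ∨ a = 1) → (b = 2 ∨ b = 3) →
      (x (2, 0) * x (3, 1) + x (2, 1) * x (3, 0)) * x (a, b) = 0 := by
    intro x hx a b ha hb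
    have z := hZ x hx
    rcases ha with rfl | rfl <;> rcases hb with rfl | rfl
    · have t := T3_eq_zero_of_sing3 hS hx 2 3 0 (by decide) (by decide) (by decide) 3
      rw [(T3_explicit _ _ _).2.2.2] at t
      simp only [row_apply, z 2 2 (by decide), z 3 2 (by decide), z 0 0 (by decide),
        z 0 1 (by decide)] at t
      linear_combination t
    · have t := T3_eq_zero_of_sing3 hS hx 2 3 0 (by decide) (by decide) (by decide) 2
      rw [(T3_explicit _ _ _).2.2.1] at t
      simp only [row_apply, z 2 3 (by decide), z 3 3 (by decide), z 0 0 (by decide),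
        z 0 1 (by decide)] at t
      linear_combination t
    · have t := T3_eq_zero_of_sing3 hS hx 2 3 1 (by decide) (by decide) (by decide) 3
      rw [(T3_explicit _ _ _).2.2.2] at t
      simp only [row_apply, z 2 2 (by decide), z 3 2 (by decide), z 1 0 (by decide),
        z 1 1 (by decide)] at t
      linear_combination t
    · have t := T3_eq_zero_of_sing3 hS hx 2 3 1 (by decide) (by decide) (by decide) 2
      rw [(T3_explicit _ _ _).2.2.1] at t
      simp only [row_apply, z 2 3 (by decide), z 3 3 (by decide), z 1 0 (by decide),
        z 1 1 (by decide)] at t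
      linear_combination t
  -- (C) `Q ≡ 0` on `W` (⇒ row 2 vanishes) or `per(P) ≡ 0` on `W`
  by_cases hQ : ∀ x ∈ W, ∀ a b : Fin 4, (a = 2 ∨ a = 3) → (b = 0 ∨ b = 1) → x (a, b) = 0
  · right
    intro x hx j
    rcases fin4_cases j with rfl | rfl | rfl | rfl
    · exact hQ x hx 2 0 (Or.inl rfl) (Or.inl rfl)
    · exact hQ x hx 2 1 (Or.inl rfl) (Or.inr rfl)
    · exact hZ x hx 2 2 (by decide)
    · exact hZ x hx 2 3 (by decide)
  have hP0 : ∀ x ∈ W, x (0, 2) * x (1, 3) + x (0, 3) * x (1, 2) = 0 := by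
    push Not at hQ
    obtain ⟨x₀, hx₀, a, b, ha, hb, hc⟩ := hQ
    have p0 : x₀ (0, 2) * x₀ (1, 3) + x₀ (0, 3) * x₀ (1, 2) = 0 :=
      (mul_eq_zero.mp (hA x₀ hx₀ a b ha hb)).resolve_right hc
    intro x hx
    have e0 := hA x hx a b ha hb
    have ep := hA (x + x₀) (W.add_mem hx hx₀) a b ha hb
    have em := hA (x - x₀) (W.sub_mem hx hx₀) a b ha hb
    simp only [Pi.add_apply, Pi.sub_apply] at ep em
    refine quad_kill (B := x (0, 2) * x₀ (1, 3) + x₀ (0, 2) * x (1, 3) + x (0, 3) * x₀ (1, 2) +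
      x₀ (0, 3) * x (1, 2)) hc e0 p0 ?_ ?_
    · linear_combination ep
    · linear_combination em
  -- (D) `P ≡ 0` on `W` (⇒ row 0 vanishes) or `per(Q) ≡ 0` on `W`
  by_cases hP : ∀ x ∈ W, ∀ a b : Fin 4, (a = 0 ∨ a = 1) → (b = 2 ∨ b = 3) → x (a, b) = 0
  · left
    intro x hx j
    rcases fin4_cases j with rfl | rfl | rfl | rfl
    · exact hZ x hx 0 0 (by decide)
    · exact hZ x hx 0 1 (by decide)
    · exact hP x hx 0 2 (Or.inl rfl) (Or.inl rfl)
    · exact hP x hx 0 3 (Or.inl rfl) (Or.inr rfl)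
  have hQ0 : ∀ x ∈ W, x (2, 0) * x (3, 1) + x (2, 1) * x (3, 0) = 0 := by
    push Not at hP
    obtain ⟨x₀, hx₀, a, b, ha, hb, hc⟩ := hP
    have p0 : x₀ (2, 0) * x₀ (3, 1) + x₀ (2, 1) * x₀ (3, 0) = 0 :=
      (mul_eq_zero.mp (hB x₀ hx₀ a b ha hb)).resolve_right hc
    intro x hx
    have e0 := hB x hx a b ha hb
    have ep := hB (x + x₀) (W.add_mem hx hx₀) a b ha hb
    have em := hB (x - x₀) (W.sub_mem hx hx₀) a b ha hb
    simp only [Pi.add_apply, Pi.sub_apply] at ep em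
    refine quad_kill (B := x (2, 0) * x₀ (3, 1) + x₀ (2, 0) * x (3, 1) + x (2, 1) * x₀ (3, 0) +
      x₀ (2, 1) * x (3, 0)) hc e0 p0 ?_ ?_
    · linear_combination ep
    · linear_combination em
  -- (E) both block projections are totally isotropic planes: `dim W ≤ 2 + 2`
  exfalso
  have hVP : finrank K (W.map (πP (K := K))) ≤ 2 := by
    refine iso_le_two _ fun v hv => ?_
    obtain ⟨x, hx, rfl⟩ := Submodule.mem_map.mp hv
    simpa using hP0 x hx
  have hVQ : finrank K (W.map (πQ (K := K))) ≤ 2 := by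
    refine iso_le_two _ fun v hv => ?_
    obtain ⟨x, hx, rfl⟩ := Submodule.mem_map.mp hv
    simpa using hQ0 x hx
  obtain ⟨Ω, hΩ_def⟩ : ∃ Ω : W →ₗ[K] ↥(W.map (πP (K := K))) × ↥(W.map (πQ (K := K))), Ω =
      (LinearMap.codRestrict (W.map (πP (K := K))) ((πP (K := K)).comp W.subtype)
          (fun w => Submodule.mem_map_of_mem w.2)).prod
        (LinearMap.codRestrict (W.map (πQ (K := K))) ((πQ (K := K)).comp W.subtype)
          (fun w => Submodule.mem_map_of_mem w.2)) := ⟨_, rfl⟩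
  have hΩ : ∀ w : W, (((Ω w).1 : Fin 4 → K), ((Ω w).2 : Fin 4 → K)) =
      (πP (K := K) (w : Fin 4 × Fin 4 → K), πQ (K := K) (w : Fin 4 × Fin 4 → K)) := fun w => by
    rw [hΩ_def]; rfl
  have hΩinj : Function.Injective Ω := by
    intro w w' h
    have h1 := congrArg (fun z : ↥(W.map (πP (K := K))) × ↥(W.map (πQ (K := K))) =>
      (((z.1 : Fin 4 → K)), ((z.2 : Fin 4 → K)))) h
    simp only [hΩ, Prod.mk.injEq] at h1
    obtain ⟨hPeq, hQeq⟩ := h1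
    apply Subtype.ext
    funext ij
    obtain ⟨i, j⟩ := ij
    have eP := fun k => congrFun hPeq k
    have eQ := fun k => congrFun hQeq k
    simp only [πP_apply, πQ_apply] at eP eQ
    rcases fin4_cases i with rfl | rfl | rfl | rfl <;>
      rcases fin4_cases j with rfl | rfl | rfl | rfl <;>
      first
        | exact eP 0 | exact eP 1 | exact eP 2 | exact eP 3
        | exact eQ 0 | exact eQ 1 | exact eQ 2 | exact eQ 3
        | (rw [hZ _ w.2 _ _ (by decide), hZ _ w'.2 _ _ (by decide)])
  have hle := LinearMap.finrank_le_finrank_of_injective hΩinj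
  rw [Module.finrank_prod] at hle
  omega

/-- Simultaneous row/column permutation `x ↦ ((i, j) ↦ x (ρ i, γ j))` as a linear equivalence. -/
def biPermL (ρ γ : Equiv.Perm (Fin 4)) : (Fin 4 × Fin 4 → K) ≃ₗ[K] (Fin 4 × Fin 4 → K) :=
  LinearEquiv.funCongrLeft K K (Equiv.prodCongr ρ γ)

@[simp] theorem biPermL_apply (ρ γ : Equiv.Perm (Fin 4)) (x : Fin 4 × Fin 4 → K) (i j : Fin 4) :
    biPermL ρ γ x (i, j) = x (ρ i, γ j) := rfl

theorem sing3_map_biPermL {W : Submodule K (Fin 4 × Fin 4 → K)} (hS : Sing3 W)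
    (ρ γ : Equiv.Perm (Fin 4)) :
    Sing3 (W.map (biPermL (K := K) ρ γ : (Fin 4 × Fin 4 → K) →ₗ[K] (Fin 4 × Fin 4 → K))) := by
  intro y hy r c hr hc
  obtain ⟨x, hx, rfl⟩ := Submodule.mem_map.mp hy
  have key : (Matrix.of fun i j => (biPermL (K := K) ρ γ : (Fin 4 × Fin 4 → K) →ₗ[K]
      (Fin 4 × Fin 4 → K)) x (i, j)).submatrix r c =
      (Matrix.of fun i j => x (i, j)).submatrix (ρ ∘ r) (γ ∘ c) := Matrix.ext fun _ _ => rfl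
  rw [key]
  exact hS x hx _ _ (ρ.injective.comp hr) (γ.injective.comp hc)

/-- **ANTI-BLOCK, general position** (transport of `anti_normal` by `biPermL`): a zero row. -/
theorem anti_case [CharZero K] {W : Submodule K (Fin 4 × Fin 4 → K)} (hS : Sing3 W)
    (h5 : 5 ≤ finrank K W) {i₁ i₂ j₁ j₂ : Fin 4} (hi : i₁ ≠ i₂) (hj : j₁ ≠ j₂)
    (hW : ∀ x ∈ W, ∀ i j, ((i = i₁ ∨ i = i₂) ↔ (j = j₁ ∨ j = j₂)) → x (i, j) = 0) :
    ∃ i : Fin 4, ∀ x ∈ W, ∀ j : Fin 4, x (i, j) = 0 := by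
  obtain ⟨ρ, hρ0, hρ1⟩ := exists_perm_zero_one hi
  obtain ⟨γ, hγ0, hγ1⟩ := exists_perm_zero_one hj
  set L : (Fin 4 × Fin 4 → K) →ₗ[K] (Fin 4 × Fin 4 → K) :=
    (biPermL (K := K) ρ γ : (Fin 4 × Fin 4 → K) →ₗ[K] (Fin 4 × Fin 4 → K)) with hL
  have hS' : Sing3 (W.map L) := sing3_map_biPermL hS ρ γ
  have h5' : 5 ≤ finrank K (W.map L) := by
    have : finrank K (W.map L) = finrank K W := LinearEquiv.finrank_map_eq _ _
    omega
  have hZ' : ∀ y ∈ W.map L, ∀ a b : Fin 4, ((a = 0 ∨ a = 1) ↔ (b = 0 ∨ b = 1)) → y (a, b) = 0 := by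
    intro y hy a b hab
    obtain ⟨x, hx, rfl⟩ := Submodule.mem_map.mp hy
    show x (ρ a, γ b) = 0
    apply hW x hx
    rw [← hρ0, ← hρ1, ← hγ0, ← hγ1]
    simpa only [Equiv.apply_eq_iff_eq] using hab
  have back : ∀ r : Fin 4, (∀ y ∈ W.map L, ∀ j, y (r, j) = 0) → ∀ x ∈ W, ∀ j, x (ρ r, j) = 0 := by
    intro r hr x hx j
    have := hr (L x) (Submodule.mem_map_of_mem hx) (γ.symm j)
    simpa [hL] using this
  rcases anti_normal hS' h5' hZ' with h0 | h2
  · exact ⟨ρ 0, back 0 h0⟩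
  · exact ⟨ρ 2, back 2 h2⟩

/-- The four pattern submodules of Part A. -/
def RowZ (i : Fin 4) : Submodule K (Fin 4 × Fin 4 → K) where
  carrier := {x | ∀ j, x (i, j) = 0}
  add_mem' := by
    intro a b ha hb j
    simp [ha j, hb j]
  zero_mem' := by
    intro j
    simp
  smul_mem' := by
    intro r a ha j
    simp [ha j]

def ColZ (j : Fin 4) : Submodule K (Fin 4 × Fin 4 → K) where
  carrier := {x | ∀ i, x (i, j) = 0}
  add_mem' := by
    intro a b ha hb i
    simp [ha i, hb i]
  zero_mem' := by
    intro i
    simp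
  smul_mem' := by
    intro r a ha i
    simp [ha i]

def CrossZ (i₀ j₀ : Fin 4) : Submodule K (Fin 4 × Fin 4 → K) where
  carrier := {x | ∀ i j, i ≠ i₀ → j ≠ j₀ → x (i, j) = 0}
  add_mem' := by
    intro a b ha hb i j hi hj
    simp [ha i j hi hj, hb i j hi hj]
  zero_mem' := by
    intro i j _ _
    simp
  smul_mem' := by
    intro r a ha i j hi hj
    simp [ha i j hi hj]

def AntiZ (i₁ i₂ j₁ j₂ : Fin 4) : Submodule K (Fin 4 × Fin 4 → K) where
  carrier := {x | ∀ i j, ((i = i₁ ∨ i = i₂) ↔ (j = j₁ ∨ j = j₂)) → x (i, j) = 0}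
  add_mem' := by
    intro a b ha hb i j hij
    simp [ha i j hij, hb i j hij]
  zero_mem' := by
    intro i j _
    simp
  smul_mem' := by
    intro r a ha i j hij
    simp [ha i j hij]

theorem mem_RowZ {i : Fin 4} {x : Fin 4 × Fin 4 → K} : x ∈ RowZ (K := K) i ↔ ∀ j, x (i, j) = 0 :=
  Iff.rfl
theorem mem_ColZ {j : Fin 4} {x : Fin 4 × Fin 4 → K} : x ∈ ColZ (K := K) j ↔ ∀ i, x (i, j) = 0 :=
  Iff.rfl
theorem mem_CrossZ {i₀ j₀ : Fin 4} {x : Fin 4 × Fin 4 → K} :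
    x ∈ CrossZ (K := K) i₀ j₀ ↔ ∀ i j, i ≠ i₀ → j ≠ j₀ → x (i, j) = 0 := Iff.rfl
theorem mem_AntiZ {i₁ i₂ j₁ j₂ : Fin 4} {x : Fin 4 × Fin 4 → K} :
    x ∈ AntiZ (K := K) i₁ i₂ j₁ j₂ ↔
      ∀ i j, ((i = i₁ ∨ i = i₂) ↔ (j = j₁ ∨ j = j₂)) → x (i, j) = 0 := Iff.rfl

/-- Index of the `42` pieces (rows, columns, crosses, proper anti-blocks). -/
abbrev PieceIdx : Type :=
  (Fin 4 ⊕ Fin 4) ⊕ ((Fin 4 × Fin 4) ⊕ {p : Fin 4 × Fin 4 × Fin 4 × Fin 4 // p.1 ≠ p.2.1 ∧ p.2.2.1 ≠ p.2.2.2})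

/-- The pieces. -/
def piece : PieceIdx → Submodule K (Fin 4 × Fin 4 → K) :=
  Sum.elim (Sum.elim RowZ ColZ)
    (Sum.elim (fun c => CrossZ c.1 c.2) (fun p => AntiZ p.1.1 p.1.2.1 p.1.2.2.1 p.1.2.2.2))

/-- Part A pointwise: every element of `W ⊆ Sing` lies in one of the pieces. -/
theorem mem_piece_of_sing3 {W : Submodule K (Fin 4 × Fin 4 → K)} (hS : Sing3 W)
    (h12 : (12 : K) ≠ 0) {x : Fin 4 × Fin 4 → K} (hx : x ∈ W) : ∃ k : PieceIdx, x ∈ piece (K := K) k := by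
  have h := Summit.ValiantsHypothesis.ValiantsHypothesis.Theorems.SymPencilPerFourSingularLocusSupportPatterns.support_of_subperm_vanish
    h12 (Matrix.of fun i j => x (i, j))
    (fun r c => hS x hx _ _ Fin.succAbove_right_injective Fin.succAbove_right_injective)
  rcases h with ⟨i, hi⟩ | ⟨j, hj⟩ | ⟨i₁, i₂, j₁, j₂, h₁, h₂, hA⟩ | ⟨i₀, j₀, hC⟩
  · exact ⟨Sum.inl (Sum.inl i), fun j => hi j⟩
  · exact ⟨Sum.inl (Sum.inr j), fun i => hj i⟩
  · exact ⟨Sum.inr (Sum.inr ⟨(i₁, i₂, j₁, j₂), h₁, h₂⟩), fun i j hij => hA i j hij⟩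
  · exact ⟨Sum.inr (Sum.inl (i₀, j₀)), fun i j hi hj => hC i j hi hj⟩

/-- **LEAF 1 — ZERO-LINE LEMMA — PROVED** (rev 2.6; the statement of rev 1's `stub_zeroLine`,
VERBATIM; memo §2).  A linear subspace of `Sing Z(per₄)` of dimension `≥ 5` lies in a cross or has an
identically-zero row or column.  Part A (`SymPencilPerFourSingularLocusSupportPatterns.
support_of_subperm_vanish`, p615473) puts every `x ∈ W` inside one of the `42` coordinate subspaces
`piece` (4 rows, 4 columns, 16 crosses, 18 proper anti-blocks); a vector space over an infinite field
is not a finite union of proper subspaces (`Submodule.exists_forall_notMem_of_forall_ne_top`), so `W`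
lies in ONE piece; rows / columns / crosses are conclusions, and a proper anti-block `[[0,P],[Q,0]]`
is `anti_case` (zero row, since `dim W ≥ 5 > 2 + 2`). [folklore] -/
theorem zeroLine [CharZero K] :
    ∀ W : Submodule K (Fin 4 × Fin 4 → K), Sing3 W → 5 ≤ finrank K W →
      InCross W ∨ (∃ i : Fin 4, ∀ x ∈ W, ∀ j : Fin 4, x (i, j) = 0) ∨
        (∃ j : Fin 4, ∀ x ∈ W, ∀ i : Fin 4, x (i, j) = 0) := by
  intro W hS h5
  have h12 : (12 : K) ≠ 0 := by norm_num
  by_contra hnot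
  have hne : ∀ k : PieceIdx, (piece (K := K) k).comap W.subtype ≠ ⊤ := by
    intro k hk
    have hall : ∀ x ∈ W, x ∈ piece (K := K) k := fun x hx => by
      have hmem : (⟨x, hx⟩ : W) ∈ (piece (K := K) k).comap W.subtype := by
        rw [hk]; exact Submodule.mem_top
      exact hmem
    rcases k with (i | j) | (c | p)
    · exact hnot (Or.inr (Or.inl ⟨i, fun x hx j => (mem_RowZ.mp (hall x hx)) j⟩))
    · exact hnot (Or.inr (Or.inr ⟨j, fun x hx i => (mem_ColZ.mp (hall x hx)) i⟩))
    · exact hnot (Or.inl ⟨c.1, c.2, fun x hx i j hi hj => (mem_CrossZ.mp (hall x hx)) i j hi hj⟩)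
    · exact hnot (Or.inr (Or.inl (anti_case hS h5 p.2.1 p.2.2
        (fun x hx => mem_AntiZ.mp (hall x hx)))))
  obtain ⟨x, hx⟩ := Submodule.exists_forall_notMem_of_forall_ne_top
    (fun k : PieceIdx => (piece (K := K) k).comap W.subtype) hne
  obtain ⟨k, hk⟩ := mem_piece_of_sing3 hS h12 x.2
  exact hx k hk

/-- **`caseFour_of`** (PROVED): the case `n_r = 4` from the kernel-plane types and the three sub-cases. -/
theorem caseFour_of [CharZero K] (hP : PerpPlanes K) (hPure : CasePure K) (hProd : CaseProduct K)
    (hGraph : CaseGraph K) : CaseFour K := by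
  intro W ρ hN hρ htop
  obtain ⟨hS, h6, h0⟩ := hN
  have h02 : (0 : Fin 4) ≠ ρ 2 := by rw [← hρ]; exact fun h => by simpa using ρ.injective h
  have h03 : (0 : Fin 4) ≠ ρ 3 := by rw [← hρ]; exact fun h => by simpa using ρ.injective h
  have h12 : ρ 1 ≠ ρ 2 := fun h => by simpa using ρ.injective h
  have h13 : ρ 1 ≠ ρ 3 := fun h => by simpa using ρ.injective h
  have h23 : ρ 2 ≠ ρ 3 := fun h => by simpa using ρ.injective h
  set D : Submodule K (Fin 4 × Fin 4 → K) := W ⊓ LinearMap.ker (rowL (K := K) (ρ 1)) with hD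
  -- rows other than `ρ 2, ρ 3` vanish on `D`
  have hrows : ∀ d ∈ D, ∀ i, i ≠ ρ 2 → i ≠ ρ 3 → row d i = 0 := by
    intro d hd i hi2 hi3
    rw [mem_kerPlane] at hd
    rcases fin4_of_perm ρ i with rfl | rfl | rfl | rfl
    · rw [hρ]; exact h0 d hd.1
    · exact hd.2
    · exact absurd rfl hi2
    · exact absurd rfl hi3
  have hD2 : finrank K D = 2 := finrank_kerPlane h6 htop
  -- every element of `D` is a perm-orthogonal pair of rows (POLARISATION)
  have hperp : ∀ d ∈ D, PermOrth (row d (ρ 2)) (row d (ρ 3)) := by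
    intro d hd
    rw [mem_kerPlane] at hd
    refine permOrth_of_T3 fun u l => ?_
    have hu : u ∈ W.map (rowL (ρ 1)) := by rw [htop]; exact Submodule.mem_top
    obtain ⟨x, hx, rfl⟩ := Submodule.mem_map.mp hu
    exact polar hS h12 h13 h23 hx hd.1 hd.2 l
  have hKiff : ∀ k, (k ∈ W ∧ row k (ρ 1) = 0) ↔ k ∈ D := fun k => mem_kerPlane.symm
  rcases hP D (ρ 2) (ρ 3) h23 hrows (by omega) hperp with hPv | hPw | ⟨-, hProdT | hGraphT⟩
  · -- row `ρ 2` vanishes on `K_r`: pure case ⇒ rows `0, ρ 2` vanish on `W`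
    have hW : ∀ x ∈ W, row x (ρ 2) = 0 :=
      hPure W ρ ⟨hS, h6, h0⟩ hρ htop fun k hk hkr => hPv k (mem_kerPlane.mpr ⟨hk, hkr⟩)
    refine Or.inr (Or.inl ⟨0, ρ 2, h02, fun x hx j => ⟨?_, ?_⟩⟩)
    · exact congrFun (h0 x hx) j
    · exact congrFun (hW x hx) j
  · -- row `ρ 3` vanishes on `K_r`: pure case with `ρ ∘ (2 3)`
    have e0 : ((Equiv.swap (2 : Fin 4) 3).trans ρ) 0 = 0 := by
      simp [Equiv.swap_apply_of_ne_of_ne, hρ]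
    have e1 : ((Equiv.swap (2 : Fin 4) 3).trans ρ) 1 = ρ 1 := by
      simp [Equiv.swap_apply_of_ne_of_ne]
    have e2 : ((Equiv.swap (2 : Fin 4) 3).trans ρ) 2 = ρ 3 := by simp
    have hW : ∀ x ∈ W, row x (ρ 3) = 0 := by
      have := hPure W ((Equiv.swap (2 : Fin 4) 3).trans ρ) ⟨hS, h6, h0⟩ e0 (by rw [e1]; exact htop)
        (fun k hk hkr => by
          rw [e2]; rw [e1] at hkr; exact hPw k (mem_kerPlane.mpr ⟨hk, hkr⟩))
      rw [e2] at this
      exact this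
    refine Or.inr (Or.inl ⟨0, ρ 3, h03, fun x hx j => ⟨?_, ?_⟩⟩)
    · exact congrFun (h0 x hx) j
    · exact congrFun (hW x hx) j
  · obtain ⟨j, c, α, β, hjc, hαβ, hmem⟩ := hProdT
    rcases hProd W ρ j c α β ⟨hS, h6, h0⟩ hρ htop hjc hαβ (fun k => (hKiff k).trans (hmem k)) with
      hV | hX
    · exact Or.inr (Or.inr (Or.inr (Or.inl hV)))
    · exact Or.inl hX
  · obtain ⟨j, c, e, hjc, he, hmem⟩ := hGraphT
    have hV := hGraph W ρ j c e ⟨hS, h6, h0⟩ hρ htop hjc he (fun k => (hKiff k).trans (hmem k))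
    exact Or.inr (Or.inr (Or.inr (Or.inr (Or.inl hV))))

/-- The TORIC ENVELOPE `{x : row₀ x = 0, rowᵢ x ∈ Aᵢ (i ≠ 0)}` of `W` (used for `ToricStructure`). -/
def toricEnvelope (W : Submodule K (Fin 4 × Fin 4 → K)) : Submodule K (Fin 4 × Fin 4 → K) where
  carrier := {x | row x 0 = 0 ∧ ∀ i : Fin 4, i ≠ 0 → row x i ∈ W.map (rowL i)}
  add_mem' := by
    rintro x y ⟨hx0, hx⟩ ⟨hy0, hy⟩
    refine ⟨by rw [row_add, hx0, hy0, add_zero], fun i hi => ?_⟩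
    rw [row_add]
    exact Submodule.add_mem _ (hx i hi) (hy i hi)
  zero_mem' := ⟨rfl, fun i hi => Submodule.zero_mem _⟩
  smul_mem' := by
    rintro c x ⟨hx0, hx⟩
    refine ⟨by rw [row_smul, hx0, smul_zero], fun i hi => ?_⟩
    rw [row_smul]
    exact Submodule.smul_mem _ c (hx i hi)

theorem mem_toricEnvelope {W : Submodule K (Fin 4 × Fin 4 → K)} {x : Fin 4 × Fin 4 → K} :
    x ∈ toricEnvelope W ↔ row x 0 = 0 ∧ ∀ i : Fin 4, i ≠ 0 → row x i ∈ W.map (rowL i) :=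
  Iff.rfl

theorem le_toricEnvelope {W : Submodule K (Fin 4 × Fin 4 → K)} (h0 : ∀ x ∈ W, row x 0 = 0) :
    W ≤ toricEnvelope W :=
  fun x hx => ⟨h0 x hx, fun i hi => Submodule.mem_map_of_mem hx⟩

/-- `dim (toric envelope) ≤ n₁ + n₂ + n₃` (it embeds into `A₁ × A₂ × A₃`). -/
theorem finrank_toricEnvelope_le (W : Submodule K (Fin 4 × Fin 4 → K)) :
    finrank K (toricEnvelope W) ≤ finrank K (W.map (rowL 1)) +
      (finrank K (W.map (rowL 2)) + finrank K (W.map (rowL 3))) := by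
  obtain ⟨F, hF⟩ : ∃ F : toricEnvelope W →ₗ[K]
      (↥(W.map (rowL (K := K) 1)) × (↥(W.map (rowL (K := K) 2)) × ↥(W.map (rowL (K := K) 3)))),
      Function.Injective F := by
    refine ⟨LinearMap.prod
        (LinearMap.codRestrict _ ((rowL 1).comp (toricEnvelope W).subtype) fun x =>
          (mem_toricEnvelope.mp x.2).2 1 (by decide))
        (LinearMap.prod
          (LinearMap.codRestrict _ ((rowL 2).comp (toricEnvelope W).subtype) fun x =>
            (mem_toricEnvelope.mp x.2).2 2 (by decide))
          (LinearMap.codRestrict _ ((rowL 3).comp (toricEnvelope W).subtype) fun x =>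
            (mem_toricEnvelope.mp x.2).2 3 (by decide))), fun x y hxy => ?_⟩
    have e1 : row (x : Fin 4 × Fin 4 → K) 1 = row (y : Fin 4 × Fin 4 → K) 1 :=
      congrArg (fun z => ((z.1 : ↥(W.map (rowL (K := K) 1))) : Fin 4 → K)) hxy
    have e2 : row (x : Fin 4 × Fin 4 → K) 2 = row (y : Fin 4 × Fin 4 → K) 2 :=
      congrArg (fun z => ((z.2.1 : ↥(W.map (rowL (K := K) 2))) : Fin 4 → K)) hxy
    have e3 : row (x : Fin 4 × Fin 4 → K) 3 = row (y : Fin 4 × Fin 4 → K) 3 :=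
      congrArg (fun z => ((z.2.2 : ↥(W.map (rowL (K := K) 3))) : Fin 4 → K)) hxy
    apply Subtype.ext
    funext ⟨i, j⟩
    have hx0 := (mem_toricEnvelope.mp x.2).1
    have hy0 := (mem_toricEnvelope.mp y.2).1
    rcases fin4_cases i with rfl | rfl | rfl | rfl
    · exact (congrFun hx0 j).trans (congrFun hy0 j).symm
    · exact congrFun e1 j
    · exact congrFun e2 j
    · exact congrFun e3 j
  calc finrank K (toricEnvelope W)
      ≤ finrank K (↥(W.map (rowL (K := K) 1)) × (↥(W.map (rowL (K := K) 2)) × ↥(W.map (rowL (K := K) 3)))) :=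
        LinearMap.finrank_le_finrank_of_injective hF
    _ = _ := by rw [Module.finrank_prod, Module.finrank_prod]

/-- **§3.8 TORIC PRODUCT STRUCTURE — PROVED** (rev 2.1; was `stub_toricStructure`). -/
theorem toricStructure : ToricStructure K := by
  intro W h6 h0 hle
  have hWV : W ≤ toricEnvelope W := le_toricEnvelope h0
  have hWle : finrank K W ≤ finrank K (toricEnvelope W) := Submodule.finrank_mono hWV
  have hV := finrank_toricEnvelope_le W
  have h1 := hle 1 (by decide)
  have h2 := hle 2 (by decide)
  have h3 := hle 3 (by decide)
  have n1 : finrank K (W.map (rowL 1)) = 2 := by omega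
  have n2 : finrank K (W.map (rowL 2)) = 2 := by omega
  have n3 : finrank K (W.map (rowL 3)) = 2 := by omega
  refine ⟨fun i hi => ?_, fun x hx0 hx => ?_⟩
  · rcases fin4_cases i with rfl | rfl | rfl | rfl
    · exact absurd rfl hi
    · exact n1
    · exact n2
    · exact n3
  · have hEq : W = toricEnvelope W := Submodule.eq_of_le_of_finrank_le hWV (by omega)
    rw [hEq]
    exact ⟨hx0, hx⟩

/-- The `4 × 4` array with rows `0, a₁, a₂, a₃`. -/
def mk4 (a₁ a₂ a₃ : Fin 4 → K) : Fin 4 × Fin 4 → K :=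
  fun ij => ![(0 : Fin 4 → K), a₁, a₂, a₃] ij.1 ij.2

@[simp] theorem row_mk4_zero (a₁ a₂ a₃ : Fin 4 → K) : row (mk4 a₁ a₂ a₃) 0 = 0 := rfl
@[simp] theorem row_mk4_one (a₁ a₂ a₃ : Fin 4 → K) : row (mk4 a₁ a₂ a₃) 1 = a₁ := rfl
@[simp] theorem row_mk4_two (a₁ a₂ a₃ : Fin 4 → K) : row (mk4 a₁ a₂ a₃) 2 = a₂ := rfl
@[simp] theorem row_mk4_three (a₁ a₂ a₃ : Fin 4 → K) : row (mk4 a₁ a₂ a₃) 3 = a₃ := rfl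

/-- Row spaces have dimension `≤ 4`. -/
theorem finrank_rowSpace_le (W : Submodule K (Fin 4 × Fin 4 → K)) (i : Fin 4) :
    finrank K (W.map (rowL i)) ≤ 4 := by
  calc finrank K (W.map (rowL i)) ≤ finrank K (Fin 4 → K) := Submodule.finrank_le _
    _ = 4 := Module.finrank_fin_fun K

/-- **`residueNorm_of`** (PROVED): the normal-form residue theorem from the three cases
(trichotomy on the live row-space dimensions + the toric glue). -/
theorem residueNorm_of [CharZero K] (h4 : CaseFour K) (h3 : CaseThree K) (hT : ToricStructure K)
    (hTT : ToricTriple K) : ResidueNorm K := by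
  intro W hN
  obtain ⟨hS, h6, h0⟩ := hN
  by_cases hex4 : ∃ i : Fin 4, i ≠ 0 ∧ W.map (rowL i) = ⊤
  · obtain ⟨i, hi, htop⟩ := hex4
    refine h4 W (Equiv.swap 1 i) ⟨hS, h6, h0⟩ ?_ (by simpa using htop)
    exact Equiv.swap_apply_of_ne_of_ne (by decide) hi.symm
  push Not at hex4
  have hle3 : ∀ i : Fin 4, i ≠ 0 → finrank K (W.map (rowL i)) ≤ 3 := by
    intro i hi
    have hle := finrank_rowSpace_le W i
    rcases Nat.lt_or_ge (finrank K (W.map (rowL i))) 4 with h | h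
    · omega
    · exfalso
      refine hex4 i hi (Submodule.eq_top_of_finrank_eq ?_)
      rw [Module.finrank_fin_fun]; omega
  by_cases hex3 : ∃ i : Fin 4, i ≠ 0 ∧ finrank K (W.map (rowL i)) = 3
  · obtain ⟨i, hi, h3i⟩ := hex3
    have hTZ := h3 W (Equiv.swap 1 i) ⟨hS, h6, h0⟩
      (Equiv.swap_apply_of_ne_of_ne (by decide) hi.symm) hle3 (by rw [Equiv.swap_apply_left]; exact h3i)
    exact Or.inr (Or.inl hTZ)
  push Not at hex3
  have hle2 : ∀ i : Fin 4, i ≠ 0 → finrank K (W.map (rowL i)) ≤ 2 := by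
    intro i hi
    have := hle3 i hi
    have := hex3 i hi
    omega
  -- toric case
  obtain ⟨hdim, hprod⟩ := hT W h6 h0 hle2
  have hvan : ∀ a₁ ∈ W.map (rowL 1), ∀ a₂ ∈ W.map (rowL 2), ∀ a₃ ∈ W.map (rowL 3), ∀ l,
      T3 a₁ a₂ a₃ l = 0 := by
    intro a₁ h₁ a₂ h₂ a₃ h₃ l
    have hx : mk4 a₁ a₂ a₃ ∈ W := by
      refine hprod _ (row_mk4_zero _ _ _) fun i hi => ?_
      rcases fin4_of_perm (Equiv.refl _) i with rfl | rfl | rfl | rfl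
      · exact absurd rfl hi
      · simpa using h₁
      · simpa using h₂
      · simpa using h₃
    simpa using T3_eq_zero_of_sing3 hS hx 1 2 3 (by decide) (by decide) (by decide) l
  obtain ⟨p, q, hpq, hA₁, hA₂, hA₃⟩ :=
    hTT _ _ _ (hdim 1 (by decide)) (hdim 2 (by decide)) (hdim 3 (by decide)) hvan
  refine Or.inr (Or.inr (Or.inl ⟨p, q, hpq, fun x hx i => ?_⟩))
  by_cases hi : i = 0
  · subst hi; exact ⟨congrFun (h0 x hx) p, congrFun (h0 x hx) q⟩
  · have hm : row x i ∈ W.map (rowL i) := Submodule.mem_map_of_mem hx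
    rcases fin4_of_perm (Equiv.refl _) i with rfl | rfl | rfl | rfl
    · exact absurd rfl hi
    · exact hA₁ _ (by simpa using hm)
    · exact hA₂ _ (by simpa using hm)
    · exact hA₃ _ (by simpa using hm)

/-- **Leaf 2 assembled** (PROVED): the one-zero-line residue from `Transport` and the cases. -/
theorem zeroLineResidue_of [CharZero K] (hTr : Transport K) (h4 : CaseFour K) (h3 : CaseThree K)
    (hT : ToricStructure K) (hTT : ToricTriple K) :
    ∀ W : Submodule K (Fin 4 × Fin 4 → K), Sing3 W → finrank K W = 6 →
      ((∃ i : Fin 4, ∀ x ∈ W, ∀ j : Fin 4, x (i, j) = 0) ∨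
        (∃ j : Fin 4, ∀ x ∈ W, ∀ i : Fin 4, x (i, j) = 0)) →
      InCross W ∨ TwoZeroRows W ∨ TwoZeroCols W ∨
        VLambdaRows W ∨ VGraphRows W ∨ VLambdaCols W ∨ VGraphCols W :=
  hTr (residueNorm_of h4 h3 hT hTT)

/-- **LEAF 2 — PROVED** (rev 2.5): the statement of rev 1's `stub_zeroLineResidue`, VERBATIM, with NO
`sorry` in its dependency cone (`permOrthPairs`, `toricStructure`, `transport`, the four CASES,
`productAbsorb`, `graphAbsorb_of`, `pureCore`, `perpPlanes`, `toricTriple`: revs 2.1–2.5). -/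
theorem zeroLineResidue [CharZero K] :
    ∀ W : Submodule K (Fin 4 × Fin 4 → K), Sing3 W → finrank K W = 6 →
      ((∃ i : Fin 4, ∀ x ∈ W, ∀ j : Fin 4, x (i, j) = 0) ∨
        (∃ j : Fin 4, ∀ x ∈ W, ∀ i : Fin 4, x (i, j) = 0)) →
      InCross W ∨ TwoZeroRows W ∨ TwoZeroCols W ∨
        VLambdaRows W ∨ VGraphRows W ∨ VLambdaCols W ∨ VGraphCols W :=
  zeroLineResidue_of transport
    (caseFour_of (perpPlanes permOrthPairs)
      (casePure_of pureCore)
      (caseProduct_of productAbsorb) (caseGraph_of (graphAbsorb_of productAbsorb)))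
    (caseThree_of (perpPlanes permOrthPairs))
    toricStructure (toricTriple permOrthPairs)

/-- **Leaf 3 — PROVED in the tree by val-width-5674-w2 g0′ (`Theorems/SymPencilPerFourExoticNoSixSquares.lean`,
`stub_exoticNoSixSquares` with the predicates unfolded, via `SymPencilPerFourExoticElemRankEight` p626744; cited here by
name, rev 2.7).**  ORIGINAL DOCSTRING: **Leaf 3 — THE EXOTICS CARRY NO PER-DIRECTION SIX-SQUARE FAMILY** (memo §4.1).  On `V_λ`, `V^gr`
and their transposes the Hessian `Hess per₄(y)` has rank `8 > 6` at the generic point (all parameter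
values: both families are single torus orbits, `V_λ ≅ V_{(1:1)}`, `V^gr ≅ V^gr_{1}`; exact rank
computation `sing_six_classification_checks.py (evidence on stmt-5674)` C5; for `V_λ` also val-width-5674-w2's `scratch/innerrank_test.py`). [folklore] -/
theorem exoticNoSixSquares [CharZero K] :
    ∀ W : Submodule K (Fin 4 × Fin 4 → K),
      (VLambdaRows W ∨ VGraphRows W ∨ VLambdaCols W ∨ VGraphCols W) → ¬ PerDirSix W :=
  fun W hW =>
    Summit.ValiantsHypothesis.ValiantsHypothesis.Theorems.SymPencilPerFourExoticNoSixSquares.stub_exoticNoSixSquares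
      W hW

/-- **Leaf 4 — PROVED in the tree by val-width-5674-w2 g0′ (p627105 `Theorems/SymPencilPerFourCrossFilter.lean`,
`stub_crossFilter` with the predicates unfolded; cited here by name, rev 2.7).**  ORIGINAL DOCSTRING: **Leaf 4 — CROSS FILTER** (memo §4.2).  A `6`-dimensional `W` inside a cross `X_{lc}` (a
hyperplane of the `7`-dimensional cross) with a per-direction family of `≤ 6` squares is an
arm-coordinate hyperplane `X_{lc} ∩ {x_e = 0}` (the `V×` orbit): on `X_{lc}` the `s²`-coefficient is the
Kronecker form `B(b) ⊗ A(a)` of the zero-diagonal `3 × 3` matrices of the two arms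
(`SymPencilPerFourSixDimCross`), of rank `rank A · rank B ∈ {0,4,6,9}`, and `rank A(a) = 3 ⟺ a₁a₂a₃ ≠ 0`;
so rank `≤ 6` on all of `W` forces `W ⊆ {a_j = 0} ∪ {b_i = 0}`, hence (irreducibility) `W` equals one
of these hyperplanes. [folklore] -/
theorem crossFilter [CharZero K] :
    ∀ W : Submodule K (Fin 4 × Fin 4 → K), finrank K W = 6 → InCross W → PerDirSix W →
      VCrossType W :=
  fun W h6 hX hP =>
    Summit.ValiantsHypothesis.ValiantsHypothesis.Theorems.SymPencilPerFourCrossFilter.stub_crossFilter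
      W h6 hX hP

/-! ## Leaf 5 — TYPED SPLIT, ALL PROVED (revs 2.8 / 3.0, val-idea-18 g4): the two-line filter
`twoLineFilter` ⟸ symmetry transport (5-T) + the Hessian reduction `twoRowDegenerate` (5a) + the
algebraic classification `twoRowClassify` (5b, rev 3.0; stated over `T3` so that a `Theorems/` hand
can take it verbatim). -/

/-- Normal position for leaf 5: rows `2` and `3` vanish on `W` (the live rows are `0, 1`). -/
def RowsTwoThreeZero (W : Submodule K (Fin 4 × Fin 4 → K)) : Prop :=
  ∀ x ∈ W, ∀ j : Fin 4, x (2, j) = 0 ∧ x (3, j) = 0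

/-- `P(α,β) := (T3 e_k α β l)_{k,l}` (the symmetric `4 × 4` matrix of `v ↦ T3 v α β`) is SINGULAR:
a non-zero `v` with `T3 v α β ≡ 0` (equivalently `det P(α,β) = -4·f(α,β) = 0`, memo §5.1). -/
def TPDegenerate (α β : Fin 4 → K) : Prop :=
  ∃ v : Fin 4 → K, v ≠ 0 ∧ ∀ l : Fin 4, T3 v α β l = 0

/-! ### 5-T — symmetry transport for `PerDirSix` and the two-row types (PROVED) -/

theorem eval_perPoly_rowPermL (σ : Equiv.Perm (Fin 4)) (x : Fin 4 × Fin 4 → K) :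
    eval (rowPermL σ x) (perPoly (Fin 4) K) = eval x (perPoly (Fin 4) K) := by
  rw [eval_perPoly, eval_perPoly]
  have : (Matrix.of fun i j => rowPermL σ x (i, j)) =
      (Matrix.of fun i j => x (i, j)).submatrix σ id := Matrix.ext fun _ _ => rfl
  rw [this, Matrix.permanent_permute_cols]

theorem eval_perPoly_transposeL (x : Fin 4 × Fin 4 → K) :
    eval (transposeL (K := K) x) (perPoly (Fin 4) K) = eval x (perPoly (Fin 4) K) := by
  rw [eval_perPoly, eval_perPoly]
  have : (Matrix.of fun i j => transposeL (K := K) x (i, j)) =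
      ((Matrix.of fun i j => x (i, j))).transpose := Matrix.ext fun _ _ => rfl
  rw [this, Matrix.permanent_transpose]

/-- `PerDirSix` is carried along any linear self-equivalence preserving `per₄`
(pre-compose the functionals `Λ_k` with `e⁻¹`). -/
theorem perDirSix_map_of_eval (e : (Fin 4 × Fin 4 → K) ≃ₗ[K] (Fin 4 × Fin 4 → K))
    (he : ∀ x, eval (e x) (perPoly (Fin 4) K) = eval x (perPoly (Fin 4) K))
    {W : Submodule K (Fin 4 × Fin 4 → K)} (hP : PerDirSix W) :
    PerDirSix (W.map (e : (Fin 4 × Fin 4 → K) →ₗ[K] (Fin 4 × Fin 4 → K))) := by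
  intro y hy
  obtain ⟨x, hx, rfl⟩ := Submodule.mem_map.mp hy
  obtain ⟨c, Λ, hfam⟩ := hP x hx
  refine ⟨c, fun k => (Λ k).comp (e.symm : (Fin 4 × Fin 4 → K) →ₗ[K] (Fin 4 × Fin 4 → K)),
    fun u => ?_⟩
  obtain ⟨e₀, e₁, hs⟩ := hfam (e.symm u)
  refine ⟨e₀, e₁, fun s => ?_⟩
  have h1 : u + s • ((e : (Fin 4 × Fin 4 → K) →ₗ[K] (Fin 4 × Fin 4 → K)) x) =
      e (e.symm u + s • x) := by simp
  rw [h1, he]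
  simpa using hs s

/-- The two-row types pull back along a row permutation. -/
theorem twoRowConcl_of_rowPerm (σ : Equiv.Perm (Fin 4)) {W W' : Submodule K (Fin 4 × Fin 4 → K)}
    (hmem : ∀ x, x ∈ W ↔ rowPermL σ x ∈ W') :
    WColType W' ∨ W2Type W' → WColType W ∨ W2Type W := by
  have hall : ∀ (x : Fin 4 × Fin 4 → K) (p q : Fin 4),
      (∀ i j : Fin 4, i ≠ p → i ≠ q → x (σ i, j) = 0) ↔
      (∀ i j : Fin 4, i ≠ σ p → i ≠ σ q → x (i, j) = 0) := by
    intro x p q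
    constructor
    · intro h i j hip hiq
      have := h (σ.symm i) j (fun e => hip (by rw [← e, Equiv.apply_symm_apply]))
        (fun e => hiq (by rw [← e, Equiv.apply_symm_apply]))
      simpa using this
    · intro h i j hip hiq
      exact h (σ i) j (σ.injective.ne hip) (σ.injective.ne hiq)
  rintro (⟨p, q, m, hpq, h⟩ | ⟨p, q, m, m', hpq, hmm, h⟩)
  · refine Or.inl ⟨σ p, σ q, m, σ.injective.ne hpq, fun x => ?_⟩
    rw [hmem x, h]
    simp only [rowPermL_apply]
    exact and_congr (hall x p q) Iff.rfl
  · refine Or.inr ⟨σ p, σ q, m, m', σ.injective.ne hpq, hmm, fun x => ?_⟩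
    rw [hmem x, h]
    simp only [rowPermL_apply]
    exact and_congr (hall x p q) Iff.rfl

/-- The two-row types pull back along transposition to the transposed types. -/
theorem twoRowConclT_of_transpose {W W' : Submodule K (Fin 4 × Fin 4 → K)}
    (hmem : ∀ x, x ∈ W ↔ transposeL x ∈ W') :
    WColType W' ∨ W2Type W' → WColTypeT W ∨ W2TypeT W := by
  rintro (⟨p, q, m, hpq, h⟩ | ⟨p, q, m, m', hpq, hmm, h⟩)
  · refine Or.inl ⟨p, q, m, hpq, fun x => ?_⟩
    rw [hmem x, h]
    simp only [transposeL_apply]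
    exact and_congr ⟨fun h' i j hjp hjq => h' j i hjp hjq, fun h' i j hip hiq => h' j i hip hiq⟩
      Iff.rfl
  · refine Or.inr ⟨p, q, m, m', hpq, hmm, fun x => ?_⟩
    rw [hmem x, h]
    simp only [transposeL_apply]
    exact and_congr ⟨fun h' i j hjp hjq => h' j i hjp hjq, fun h' i j hip hiq => h' j i hip hiq⟩
      Iff.rfl

/-- A permutation moving `2 ↦ p`, `3 ↦ q`. -/
theorem exists_perm_two_three {p q : Fin 4} (hpq : p ≠ q) :
    ∃ σ : Equiv.Perm (Fin 4), σ 2 = p ∧ σ 3 = q := by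
  obtain ⟨τ, h0, h1⟩ := exists_perm_zero_one hpq
  have e2 : ((Equiv.swap (0 : Fin 4) 2).trans (Equiv.swap 1 3)) 2 = 0 := by decide
  have e3 : ((Equiv.swap (0 : Fin 4) 2).trans (Equiv.swap 1 3)) 3 = 1 := by decide
  refine ⟨((Equiv.swap (0 : Fin 4) 2).trans (Equiv.swap 1 3)).trans τ, ?_, ?_⟩
  · rw [Equiv.trans_apply, e2, h0]
  · rw [Equiv.trans_apply, e3, h1]

/-! ### 5a — the Hessian reduction on the two live rows (PROVED) -/

/-- Test points for 5a: rows `0, 1` zero, row `2 := v`, row `3 := w` — linear in `(v, w)`. -/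
def tpL : ((Fin 4 → K) × (Fin 4 → K)) →ₗ[K] (Fin 4 × Fin 4 → K) where
  toFun p := fun ij => if ij.1 = 2 then p.1 ij.2 else if ij.1 = 3 then p.2 ij.2 else 0
  map_add' p p' := by
    funext ij
    simp only [Prod.fst_add, Prod.snd_add, Pi.add_apply]
    split_ifs <;> simp
  map_smul' c p := by
    funext ij
    simp only [Prod.smul_fst, Prod.smul_snd, Pi.smul_apply, smul_eq_mul, RingHom.id_apply]
    split_ifs <;> simp

@[simp] theorem tpL_apply_zero (p : (Fin 4 → K) × (Fin 4 → K)) (j : Fin 4) :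
    tpL p (0, j) = 0 := by simp [tpL]
@[simp] theorem tpL_apply_one (p : (Fin 4 → K) × (Fin 4 → K)) (j : Fin 4) :
    tpL p (1, j) = 0 := by simp [tpL]
@[simp] theorem tpL_apply_two (p : (Fin 4 → K) × (Fin 4 → K)) (j : Fin 4) :
    tpL p (2, j) = p.1 j := by simp [tpL]
@[simp] theorem tpL_apply_three (p : (Fin 4 → K) × (Fin 4 → K)) (j : Fin 4) :
    tpL p (3, j) = p.2 j := by simp [tpL]

/-- On the test points, `per₄ (tp(v,w) + s y) = s² · Σ_l w_l · T3 v y₀ y₁ l` when rows `2, 3` of `y`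
vanish: the `s²`-coefficient is the bilinear form `wᵀ P(y₀,y₁) v`. -/
theorem eval_tp_add_smul (y : Fin 4 × Fin 4 → K) (h2 : ∀ j, y (2, j) = 0) (h3 : ∀ j, y (3, j) = 0)
    (v w : Fin 4 → K) (s : K) :
    eval (tpL (v, w) + s • y) (perPoly (Fin 4) K) =
      s ^ 2 * ∑ l, w l * T3 v (row y 0) (row y 1) l := by
  obtain ⟨t0, t1, t2, t3⟩ := T3_explicit v (row y 0) (row y 1)
  rw [eval_perPoly, Matrix.permanent_fin_four_row, Fin.sum_univ_four, t0, t1, t2, t3]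
  simp only [Matrix.of_apply, Pi.add_apply, Pi.smul_apply, smul_eq_mul, tpL_apply_zero,
    tpL_apply_one, tpL_apply_two, tpL_apply_three, h2, h3, row_apply, mul_zero, add_zero, zero_add]
  ring

/-- `Σ_l w_l T3 v α β l = Σ_l v_l T3 w α β l` (both are `per(v, w, α, β)`). -/
theorem sum_T3_symm (v w α β : Fin 4 → K) :
    ∑ l, w l * T3 v α β l = ∑ l, v l * T3 w α β l := by
  obtain ⟨a0, a1, a2, a3⟩ := T3_explicit v α β
  obtain ⟨b0, b1, b2, b3⟩ := T3_explicit w α β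
  rw [Fin.sum_univ_four, Fin.sum_univ_four, a0, a1, a2, a3, b0, b1, b2, b3]
  ring

theorem sum_T3_single (v α β : Fin 4 → K) (l : Fin 4) :
    ∑ l', (Pi.single l (1 : K) : Fin 4 → K) l' * T3 v α β l' = T3 v α β l := by
  rw [Fin.sum_univ_four]
  fin_cases l <;> simp

/-- **5a (PROVED).**  In the normal position, a per-direction family of `≤ 6` squares forces
`P(y₀, y₁)` singular for every `y ∈ W`: on the `8`-dimensional block of test points `(v, w)` the
`s²`-coefficient `wᵀ P v` equals `Σ_{k<6} c_k λ_k(v,w)²`; a common-kernel vector `(v₀, w₀) ≠ 0` of the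
six functionals gives, by polarisation, `P v₀ = 0` and `Pᵀ w₀ = 0`; `P` is symmetric. -/
theorem twoRowDegenerate [CharZero K] (W : Submodule K (Fin 4 × Fin 4 → K))
    (hZ : RowsTwoThreeZero W) (hP : PerDirSix W) :
    ∀ y ∈ W, TPDegenerate (row y 0) (row y 1) := by
  intro y hy
  have h2 : ∀ j, y (2, j) = 0 := fun j => (hZ y hy j).1
  have h3 : ∀ j, y (3, j) = 0 := fun j => (hZ y hy j).2
  obtain ⟨c, Λ, hfam⟩ := hP y hy
  -- (Q): the bilinear form equals the six-square form on test points
  have hQ : ∀ v w : Fin 4 → K,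
      ∑ l, w l * T3 v (row y 0) (row y 1) l = ∑ k, c k * (Λ k (tpL (v, w))) ^ 2 := by
    intro v w
    obtain ⟨e₀, e₁, hs⟩ := hfam (tpL (v, w))
    have h0 := hs 0
    have h1 := hs 1
    have hm := hs (-1)
    rw [eval_tp_add_smul y h2 h3] at h0 h1 hm
    have h22 : (2 : K) * (∑ l, w l * T3 v (row y 0) (row y 1) l -
        ∑ k, c k * (Λ k (tpL (v, w))) ^ 2) = 0 := by
      linear_combination h1 + hm - 2 * h0
    rcases mul_eq_zero.mp h22 with h | h
    · exact absurd h two_ne_zero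
    · exact sub_eq_zero.mp h
  -- a common-kernel vector of the six functionals on the 8-dimensional block
  let L : ((Fin 4 → K) × (Fin 4 → K)) →ₗ[K] (Fin 6 → K) := LinearMap.pi fun k => (Λ k).comp tpL
  have hker : LinearMap.ker L ≠ ⊥ := by
    apply LinearMap.ker_ne_bot_of_finrank_lt
    simp [Module.finrank_prod]
  obtain ⟨p₀, hp₀L, hp₀⟩ := (Submodule.ne_bot_iff _).mp hker
  have hΛ0 : ∀ k, Λ k (tpL p₀) = 0 := fun k => by
    have := LinearMap.mem_ker.mp hp₀L
    simpa [L] using congr_fun this k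
  obtain ⟨v₀, w₀⟩ := p₀
  -- polarisation
  have hF : ∀ v w : Fin 4 → K,
      ∑ l, w₀ l * T3 v (row y 0) (row y 1) l + ∑ l, w l * T3 v₀ (row y 0) (row y 1) l = 0 := by
    intro v w
    have hsum := hQ (v + v₀) (w + w₀)
    have hvw := hQ v w
    have h00 := hQ v₀ w₀
    have hadd : tpL (v + v₀, w + w₀) = tpL (v, w) + tpL (v₀, w₀) := by
      rw [← map_add]; rfl
    rw [hadd] at hsum
    simp only [map_add, hΛ0, add_zero] at hsum
    simp only [hΛ0] at h00
    have e1 : ∑ l, (w + w₀) l * T3 (v + v₀) (row y 0) (row y 1) l =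
        ∑ l, w l * T3 v (row y 0) (row y 1) l + ∑ l, w₀ l * T3 v (row y 0) (row y 1) l +
        ∑ l, w l * T3 v₀ (row y 0) (row y 1) l + ∑ l, w₀ l * T3 v₀ (row y 0) (row y 1) l := by
      simp only [Pi.add_apply, T3_add₁, add_mul, mul_add, Finset.sum_add_distrib]
      ring
    have e2 : ∑ k : Fin 6, c k * (0 : K) ^ 2 = 0 := by simp
    linear_combination hsum - hvw - h00 - e2 - e1
  have hFw : ∀ v, ∑ l, w₀ l * T3 v (row y 0) (row y 1) l = 0 := fun v => by
    simpa [T3_zero₁] using hF v 0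
  have hFv : ∀ w : Fin 4 → K, ∑ l, w l * T3 v₀ (row y 0) (row y 1) l = 0 := fun w => by
    simpa [T3_zero₁] using hF 0 w
  by_cases hv : v₀ = 0
  · have hw : w₀ ≠ 0 := by
      rintro rfl
      exact hp₀ (by rw [hv]; rfl)
    refine ⟨w₀, hw, fun l => ?_⟩
    have := hFw (Pi.single l 1)
    rw [sum_T3_symm] at this
    rwa [sum_T3_single] at this
  · refine ⟨v₀, hv, fun l => ?_⟩
    have := hFv (Pi.single l 1)
    rwa [sum_T3_single] at this

/-! ### 5b-1 — the pencil determinant `Δ` (Cayley form) and `TPDegenerate ⇒ Δ = 0` (PROVED) -/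

/-- The Cayley form: `Δ6 a b c d e f = det [[0,f,e,d],[f,0,c,b],[e,c,0,a],[d,b,a,0]]`
(python-verified, `compute/check5b.py`). -/
def Δ6 (a b c d e f : K) : K :=
  (a * f) ^ 2 + (b * e) ^ 2 + (c * d) ^ 2 - 2 * (a * f) * (b * e) - 2 * (a * f) * (c * d)
    - 2 * (b * e) * (c * d)

/-- `ΔP α β`: the determinant of the `4 × 4` system `v ↦ (T3 v α β l)_l`, whose matrix has zero
diagonal and off-diagonal entries the pair permanents `pairPerm α β` of the complementary pair. -/
def ΔP (α β : Fin 4 → K) : K :=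
  Δ6 (pairPerm α β 0 1) (pairPerm α β 0 2) (pairPerm α β 0 3) (pairPerm α β 1 2)
    (pairPerm α β 1 3) (pairPerm α β 2 3)

/-- The system `T3 v α β = 0` written with pair permanents. -/
theorem T3_pairPerm (v α β : Fin 4 → K) :
    T3 v α β 0 = v 1 * pairPerm α β 2 3 + v 2 * pairPerm α β 1 3 + v 3 * pairPerm α β 1 2 ∧
    T3 v α β 1 = v 0 * pairPerm α β 2 3 + v 2 * pairPerm α β 0 3 + v 3 * pairPerm α β 0 2 ∧
    T3 v α β 2 = v 0 * pairPerm α β 1 3 + v 1 * pairPerm α β 0 3 + v 3 * pairPerm α β 0 1 ∧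
    T3 v α β 3 = v 0 * pairPerm α β 1 2 + v 1 * pairPerm α β 0 2 + v 2 * pairPerm α β 0 1 := by
  obtain ⟨h0, h1, h2, h3⟩ := T3_explicit v α β
  refine ⟨?_, ?_, ?_, ?_⟩
  · rw [h0]; unfold pairPerm; ring
  · rw [h1]; unfold pairPerm; ring
  · rw [h2]; unfold pairPerm; ring
  · rw [h3]; unfold pairPerm; ring

/-- **5b-1 (PROVED).** A nonzero kernel vector of the system forces its determinant to vanish
(`adj(P) · P = det P · I`, with the adjugate written out). -/
theorem ΔP_eq_zero_of_tpDegenerate {α β : Fin 4 → K} (h : TPDegenerate α β) : ΔP α β = 0 := by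
  obtain ⟨v, hv, hT⟩ := h
  obtain ⟨e0, e1, e2, e3⟩ := T3_pairPerm v α β
  have h0 := hT 0; have h1 := hT 1; have h2 := hT 2; have h3 := hT 3
  rw [e0] at h0; rw [e1] at h1; rw [e2] at h2; rw [e3] at h3
  set a := pairPerm α β 0 1
  set b := pairPerm α β 0 2
  set c := pairPerm α β 0 3
  set d := pairPerm α β 1 2
  set e := pairPerm α β 1 3
  set f := pairPerm α β 2 3
  have k0 : ΔP α β * v 0 = 0 := by
    show Δ6 a b c d e f * v 0 = 0
    unfold Δ6
    linear_combination (2 * a * b * c) * h0 + (-a * c * d - a * b * e + a ^ 2 * f) * h1 +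
      (-b * c * d + b ^ 2 * e - a * b * f) * h2 + (c ^ 2 * d - b * c * e - a * c * f) * h3
  have k1 : ΔP α β * v 1 = 0 := by
    show Δ6 a b c d e f * v 1 = 0
    unfold Δ6
    linear_combination (-a * c * d - a * b * e + a ^ 2 * f) * h0 + (2 * a * d * e) * h1 +
      (c * d ^ 2 - b * d * e - a * d * f) * h2 + (-c * d * e + b * e ^ 2 - a * e * f) * h3
  have k2 : ΔP α β * v 2 = 0 := by
    show Δ6 a b c d e f * v 2 = 0
    unfold Δ6
    linear_combination (-b * c * d + b ^ 2 * e - a * b * f) * h0 +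
      (c * d ^ 2 - b * d * e - a * d * f) * h1 + (2 * b * d * f) * h2 +
      (-c * d * f - b * e * f + a * f ^ 2) * h3
  have k3 : ΔP α β * v 3 = 0 := by
    show Δ6 a b c d e f * v 3 = 0
    unfold Δ6
    linear_combination (c ^ 2 * d - b * c * e - a * c * f) * h0 +
      (-c * d * e + b * e ^ 2 - a * e * f) * h1 + (-c * d * f - b * e * f + a * f ^ 2) * h2 +
      (2 * c * e * f) * h3
  by_contra hΔ
  apply hv
  funext i
  fin_cases i
  · exact (mul_eq_zero.mp k0).resolve_left hΔ
  · exact (mul_eq_zero.mp k1).resolve_left hΔ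
  · exact (mul_eq_zero.mp k2).resolve_left hΔ
  · exact (mul_eq_zero.mp k3).resolve_left hΔ

/-- `Δ` along the two-row slice: for `y ∈ W` (rows `2, 3` zero) the pencil determinant vanishes. -/
theorem ΔP_rows_eq_zero {W : Submodule K (Fin 4 × Fin 4 → K)}
    (hTP : ∀ y ∈ W, TPDegenerate (row y 0) (row y 1)) :
    ∀ y ∈ W, ΔP (row y 0) (row y 1) = 0 :=
  fun y hy => ΔP_eq_zero_of_tpDegenerate (hTP y hy)

/-! ### 5b-2 — algebra of `Δ`: symmetry, homogeneity, the `t → 0` limit, test-vector identities -/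

theorem pairPerm_smul_left (t : K) (α β : Fin 4 → K) (i j : Fin 4) :
    pairPerm (t • α) β i j = t * pairPerm α β i j := by
  simp only [pairPerm, Pi.smul_apply, smul_eq_mul]; ring

theorem pairPerm_add_smul_right (t : K) (α β b : Fin 4 → K) (i j : Fin 4) :
    pairPerm α (t • β + b) i j = t * pairPerm α β i j + pairPerm α b i j := by
  simp only [pairPerm, Pi.add_apply, Pi.smul_apply, smul_eq_mul]; ring

theorem ΔP_comm (α β : Fin 4 → K) : ΔP α β = ΔP β α := by
  unfold ΔP; rw [pairPerm_comm α β 0 1, pairPerm_comm α β 0 2, pairPerm_comm α β 0 3,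
    pairPerm_comm α β 1 2, pairPerm_comm α β 1 3, pairPerm_comm α β 2 3]

theorem ΔP_smul_left (t : K) (α β : Fin 4 → K) : ΔP (t • α) β = t ^ 4 * ΔP α β := by
  unfold ΔP Δ6; simp only [pairPerm_smul_left]; ring

/-- The `t → 0` limit: a polynomial of degree `≤ 4` vanishing at `t = 1, …, 5` vanishes at `0`
(fifth finite difference), applied to `t ↦ Δ6 (t p + q)`. -/
theorem Δ6_limit [CharZero K] (p q : Fin 6 → K)
    (h : ∀ t : K, t ≠ 0 → Δ6 (t * p 0 + q 0) (t * p 1 + q 1) (t * p 2 + q 2) (t * p 3 + q 3)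
      (t * p 4 + q 4) (t * p 5 + q 5) = 0) :
    Δ6 (q 0) (q 1) (q 2) (q 3) (q 4) (q 5) = 0 := by
  have h1 := h 1 one_ne_zero
  have h2 := h 2 two_ne_zero
  have h3 := h 3 (by norm_num)
  have h4 := h 4 (by norm_num)
  have h5 := h 5 (by norm_num)
  unfold Δ6 at h1 h2 h3 h4 h5 ⊢
  linear_combination 5 * h1 - 10 * h2 + 10 * h3 - 5 * h4 + h5

/-- `Δ(α, t β + b) = 0` for all `t ≠ 0` forces `Δ(α, b) = 0`. -/
theorem ΔP_limit [CharZero K] (α β b : Fin 4 → K)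
    (h : ∀ t : K, t ≠ 0 → ΔP α (t • β + b) = 0) : ΔP α b = 0 := by
  have := Δ6_limit
    ![pairPerm α β 0 1, pairPerm α β 0 2, pairPerm α β 0 3, pairPerm α β 1 2, pairPerm α β 1 3,
      pairPerm α β 2 3]
    ![pairPerm α b 0 1, pairPerm α b 0 2, pairPerm α b 0 3, pairPerm α b 1 2, pairPerm α b 1 3,
      pairPerm α b 2 3] (fun t ht => by
      have h' := h t ht
      unfold ΔP at h'
      simp only [pairPerm_add_smul_right] at h'
      simpa using h')
  simpa [ΔP] using this

/-- Test vectors for the coordinate-plane lemma: `a_j = 0`, `a_i = t`, the other two entries `1`. -/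
theorem ΔP_test_t011 (t : K) (b : Fin 4 → K) :
    ΔP ![t, 0, 1, 1] b = -4 * b 1 ^ 2 * t * (t * b 2 * b 3 + b 0 * (b 2 + b 3)) := by
  simp [ΔP, Δ6, pairPerm]; ring

theorem ΔP_test_0t11 (t : K) (b : Fin 4 → K) :
    ΔP ![0, t, 1, 1] b = -4 * b 0 ^ 2 * t * (t * b 2 * b 3 + b 1 * (b 2 + b 3)) := by
  simp [ΔP, Δ6, pairPerm]; ring

theorem ΔP_test_01t1 (t : K) (b : Fin 4 → K) :
    ΔP ![0, 1, t, 1] b = -4 * b 0 ^ 2 * t * (t * b 1 * b 3 + b 2 * (b 1 + b 3)) := by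
  simp [ΔP, Δ6, pairPerm]; ring

theorem ΔP_test_011t (t : K) (b : Fin 4 → K) :
    ΔP ![0, 1, 1, t] b = -4 * b 0 ^ 2 * t * (t * b 1 * b 2 + b 3 * (b 1 + b 2)) := by
  simp [ΔP, Δ6, pairPerm]; ring

/-- From the `t = 1, 2` instances of a test family: the triple product vanishes. -/
theorem triple_zero_of_tests [CharZero K] {x y z w : K}
    (E1 : -4 * x ^ 2 * 1 * (1 * y * z + w * (y + z)) = 0)
    (E2 : -4 * x ^ 2 * 2 * (2 * y * z + w * (y + z)) = 0) : x * y * z = 0 := by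
  have h8 : (-8 : K) * (x ^ 2 * y * z) = 0 := by linear_combination E2 - 2 * E1
  have h' : x ^ 2 * y * z = 0 := (mul_eq_zero.mp h8).resolve_left (by norm_num)
  have : (x * y * z) * x = 0 := by linear_combination h'
  rcases mul_eq_zero.mp this with h | h
  · exact h
  · rw [h]; ring

/-- **Coordinate-plane lemma (PROVED).** If `Δ(a, b) = 0` for every `a`, then every triple product
of coordinates of `b` vanishes, i.e. `b` has at most two nonzero coordinates. -/
theorem triples_zero_of_ΔP [CharZero K] (b : Fin 4 → K) (h : ∀ a : Fin 4 → K, ΔP a b = 0) :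
    b 1 * b 2 * b 3 = 0 ∧ b 0 * b 2 * b 3 = 0 ∧ b 0 * b 1 * b 3 = 0 ∧ b 0 * b 1 * b 2 = 0 := by
  refine ⟨?_, ?_, ?_, ?_⟩
  · have E1 := h ![1, 0, 1, 1]; have E2 := h ![2, 0, 1, 1]
    rw [ΔP_test_t011] at E1 E2
    exact triple_zero_of_tests E1 E2
  · have E1 := h ![0, 1, 1, 1]; have E2 := h ![0, 2, 1, 1]
    rw [ΔP_test_0t11] at E1 E2
    exact triple_zero_of_tests E1 E2
  · have E1 := h ![0, 1, 1, 1]; have E2 := h ![0, 1, 2, 1]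
    rw [ΔP_test_01t1] at E1 E2
    exact triple_zero_of_tests E1 E2
  · have E1 := h ![0, 1, 1, 1]; have E2 := h ![0, 1, 1, 2]
    rw [ΔP_test_011t] at E1 E2
    exact triple_zero_of_tests E1 E2

/-- Four vanishing triple products put `b` in a coordinate `2`-plane. -/
theorem exists_pair_support {b : Fin 4 → K}
    (h : b 1 * b 2 * b 3 = 0 ∧ b 0 * b 2 * b 3 = 0 ∧ b 0 * b 1 * b 3 = 0 ∧ b 0 * b 1 * b 2 = 0) :
    ∃ n n' : Fin 4, n ≠ n' ∧ ∀ k : Fin 4, k ≠ n → k ≠ n' → b k = 0 := by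
  obtain ⟨h123, h023, h013, h012⟩ := h
  have key : ∀ n n' : Fin 4, n ≠ n' → (∀ k : Fin 4, k ≠ n → k ≠ n' → b k = 0) →
      ∃ n n' : Fin 4, n ≠ n' ∧ ∀ k : Fin 4, k ≠ n → k ≠ n' → b k = 0 :=
    fun n n' hnn' hk => ⟨n, n', hnn', hk⟩
  by_cases h0 : b 0 = 0
  · by_cases h1 : b 1 = 0
    · exact key 2 3 (by decide) fun k hk2 hk3 => by
        fin_cases k <;> simp_all
    · by_cases h2 : b 2 = 0
      · exact key 1 3 (by decide) fun k hk1 hk3 => by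
          fin_cases k <;> simp_all
      · have h3 : b 3 = 0 := by
          rcases mul_eq_zero.mp h123 with h | h
          · rcases mul_eq_zero.mp h with h | h
            · exact absurd h h1
            · exact absurd h h2
          · exact h
        exact key 1 2 (by decide) fun k hk1 hk2 => by
          fin_cases k <;> simp_all
  · by_cases h1 : b 1 = 0
    · by_cases h2 : b 2 = 0
      · exact key 0 3 (by decide) fun k hk0 hk3 => by
          fin_cases k <;> simp_all
      · have h3 : b 3 = 0 := by
          rcases mul_eq_zero.mp h023 with h | h
          · rcases mul_eq_zero.mp h with h | h
            · exact absurd h h0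
            · exact absurd h h2
          · exact h
        exact key 0 2 (by decide) fun k hk0 hk2 => by
          fin_cases k <;> simp_all
    · have h2 : b 2 = 0 := by
        rcases mul_eq_zero.mp h012 with h | h
        · rcases mul_eq_zero.mp h with h | h
          · exact absurd h h0
          · exact absurd h h1
        · exact h
      have h3 : b 3 = 0 := by
        rcases mul_eq_zero.mp h013 with h | h
        · rcases mul_eq_zero.mp h with h | h
          · exact absurd h h0
          · exact absurd h h1
        · exact h
      exact key 0 1 (by decide) fun k hk0 hk1 => by
        fin_cases k <;> simp_all

/-- Fibre identities for the graph step: `α₃ = 0`, free entry `β₃ = 1` (resp. `α₂ = 0`, `β₂ = 1`). -/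
theorem ΔP_fibre3 (α β : Fin 4 → K) (hα : α 3 = 0) (hβ : β 3 = 1) :
    ΔP α β = -4 * α 0 * α 1 * α 2 * (α 0 * β 1 * β 2 + α 1 * β 0 * β 2 + α 2 * β 0 * β 1) := by
  simp [ΔP, Δ6, pairPerm, hα, hβ]; ring

theorem ΔP_fibre2 (α β : Fin 4 → K) (hα : α 2 = 0) (hβ : β 2 = 1) :
    ΔP α β = -4 * α 0 * α 1 * α 3 * (α 0 * β 1 * β 3 + α 1 * β 0 * β 3 + α 3 * β 0 * β 1) := by
  simp [ΔP, Δ6, pairPerm, hα, hβ]; ring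

/-- Pivot identities for the non-coordinate hyperplane case (pivot coordinate `3`, `c_i = n_i b_i`,
`a = b ∘ r` for test points `r ∈ ker c`), and the two final test points. -/
theorem ΔP_pivot01m (n b : Fin 4 → K) :
    ΔP ![b 0 * (n 3 * b 3), -(b 1 * (n 3 * b 3)), 0, -(b 3 * (n 0 * b 0 - n 1 * b 1))] b =
      (b 0 * b 1 * b 2 * b 3) ^ 2 * (4 * (n 3 * b 3) ^ 2 * (n 0 * b 0 - n 1 * b 1) ^ 2) := by
  simp [ΔP, Δ6, pairPerm]; ring

theorem ΔP_pivot01p (n b : Fin 4 → K) :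
    ΔP ![b 0 * (n 3 * b 3), b 1 * (n 3 * b 3), 0, -(b 3 * (n 0 * b 0 + n 1 * b 1))] b =
      (b 0 * b 1 * b 2 * b 3) ^ 2 * (4 * (n 3 * b 3) ^ 2 * (n 0 * b 0 + n 1 * b 1) *
        (2 * (n 3 * b 3) - n 0 * b 0 - n 1 * b 1)) := by
  simp [ΔP, Δ6, pairPerm]; ring

theorem ΔP_pivot02m (n b : Fin 4 → K) :
    ΔP ![b 0 * (n 3 * b 3), 0, -(b 2 * (n 3 * b 3)), -(b 3 * (n 0 * b 0 - n 2 * b 2))] b =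
      (b 0 * b 1 * b 2 * b 3) ^ 2 * (4 * (n 3 * b 3) ^ 2 * (n 0 * b 0 - n 2 * b 2) ^ 2) := by
  simp [ΔP, Δ6, pairPerm]; ring

theorem ΔP_final1110 (b : Fin 4 → K) :
    ΔP ![b 0, b 1, b 2, 0] b = (b 0 * b 1 * b 2 * b 3) ^ 2 * (-12) := by
  simp [ΔP, Δ6, pairPerm]; ring

theorem ΔP_final11mm (b : Fin 4 → K) :
    ΔP ![b 0, b 1, -b 2, -b 3] b = (b 0 * b 1 * b 2 * b 3) ^ 2 * 16 := by
  simp [ΔP, Δ6, pairPerm]; ring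

/-! ### 5b — the algebraic classification (PROVED, rev 3.0) -/

/-! **5b `twoRowClassify` (memo §5.3; the stub `stub_twoRowClassify` up to rev 2.8, PROVED in rev 3.0 below).**  A `6`-dimensional `W` supported
on rows `0, 1` such that `P(y₀, y₁)` is singular for every `y ∈ W` is `W_col`-type
(`rows{0,1} × (columns ≠ m)`) or `W₂`-type (one row free, the other in a coordinate `2`-plane).
Paper proof: `det P(α,β) = -4 f(α,β)`, `f = Σ_{i≠j} α_i² β_j² Π_{k∉{i,j}} α_k β_k
= (Σ_i α_i Π_{k≠i} β_k)(Σ_j β_j Π_{k≠j} α_k) − 4 Π_k α_k β_k`; (i) if `W → K⁴_α` is onto, its kernel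
is a `2`-plane `B` with `f(K⁴, B) = 0` (scale `(tα, tβ + b)`), which forces `b_i b_k b_{k'} = 0` on `B`,
so `B` is a coordinate plane, and then coefficient extraction kills the graph map ⇒ `W₂`; (ii) else
both projections are hyperplanes `A, B` and `W = A ⊕ B`; `f(A, B) = 0`; if `A = {α_m = 0}` then
`f|_{α_m=0} = β_m² (Π_{i≠m} α_i) Σ_{i≠m} α_i Π_{k∉{i,m}} β_k` forces `B ⊆ {β_m = 0} ∪ ⋃ span(e_m, e_i)`
⇒ `B = {β_m = 0}` ⇒ `W_col`; if neither is a coordinate hyperplane, rescaling `r = α/β` (`β ∈ B` with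
no zero coordinate) puts a hyperplane inside `{e₁(r) e₃(r) = 4 e₄(r)}`, impossible (the UFD step).
Why it might fail: only through a slip in case (ii)'s last step; exact finite-field censuses C11a/b
(evidence on stmt-5674) agree. [folklore] -/

/-! ### 5b-3 — two-row matrices, transports, the two cases, and the case split (driver PROVED) -/

/-- The matrix with rows `0, 1` given by `p = (α, β)` and rows `2, 3` zero; linear in `p`. -/
def mkL : ((Fin 4 → K) × (Fin 4 → K)) →ₗ[K] (Fin 4 × Fin 4 → K) where
  toFun p := fun ij => if ij.1 = 0 then p.1 ij.2 else if ij.1 = 1 then p.2 ij.2 else 0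
  map_add' p p' := by
    funext ij
    simp only [Prod.fst_add, Prod.snd_add, Pi.add_apply]
    split_ifs <;> simp
  map_smul' c p := by
    funext ij
    simp only [Prod.smul_fst, Prod.smul_snd, Pi.smul_apply, smul_eq_mul, RingHom.id_apply]
    split_ifs <;> simp

@[simp] theorem mkL_apply_zero (p : (Fin 4 → K) × (Fin 4 → K)) (j : Fin 4) :
    mkL p (0, j) = p.1 j := by simp [mkL]
@[simp] theorem mkL_apply_one (p : (Fin 4 → K) × (Fin 4 → K)) (j : Fin 4) :
    mkL p (1, j) = p.2 j := by simp [mkL]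
@[simp] theorem mkL_apply_two (p : (Fin 4 → K) × (Fin 4 → K)) (j : Fin 4) :
    mkL p (2, j) = 0 := by simp [mkL]
@[simp] theorem mkL_apply_three (p : (Fin 4 → K) × (Fin 4 → K)) (j : Fin 4) :
    mkL p (3, j) = 0 := by simp [mkL]
theorem row_mkL_zero (p : (Fin 4 → K) × (Fin 4 → K)) : row (mkL p) 0 = p.1 :=
  funext fun j => mkL_apply_zero p j
theorem row_mkL_one (p : (Fin 4 → K) × (Fin 4 → K)) : row (mkL p) 1 = p.2 :=
  funext fun j => mkL_apply_one p j

/-- A matrix with rows `2, 3` zero is `mkL` of its first two rows. -/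
theorem mkL_rows_eq (x : Fin 4 × Fin 4 → K) (h : ∀ j, x (2, j) = 0 ∧ x (3, j) = 0) :
    mkL (row x 0, row x 1) = x := by
  funext ij
  obtain ⟨i, j⟩ := ij
  fin_cases i
  · simp
  · simp
  · simp [(h j).1]
  · simp [(h j).2]

theorem eq_zero_of_rows (x : Fin 4 × Fin 4 → K) (h : ∀ j, x (2, j) = 0 ∧ x (3, j) = 0)
    (h0 : row x 0 = 0) (h1 : row x 1 = 0) : x = 0 := by
  rw [← mkL_rows_eq x h, h0, h1]
  exact map_zero mkL

/-- Column permutation `x ↦ ((i, j) ↦ x (i, γ j))`. -/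
def colPermL (γ : Equiv.Perm (Fin 4)) : (Fin 4 × Fin 4 → K) ≃ₗ[K] (Fin 4 × Fin 4 → K) :=
  biPermL 1 γ

@[simp] theorem colPermL_apply (γ : Equiv.Perm (Fin 4)) (x : Fin 4 × Fin 4 → K) (i j : Fin 4) :
    colPermL γ x (i, j) = x (i, γ j) := rfl

theorem row_colPermL (γ : Equiv.Perm (Fin 4)) (x : Fin 4 × Fin 4 → K) (i : Fin 4) :
    row (colPermL γ x) i = row x i ∘ γ := rfl

/-- `TPDegenerate` is invariant under a simultaneous permutation of the coordinates. -/
theorem tpDegenerate_comp_of (γ : Equiv.Perm (Fin 4)) {α β : Fin 4 → K} (h : TPDegenerate α β) :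
    TPDegenerate (α ∘ γ) (β ∘ γ) := by
  obtain ⟨v, hv, hT⟩ := h
  refine ⟨v ∘ γ, fun h0 => hv ?_, fun l => by rw [T3_perm]; exact hT (γ l)⟩
  funext i
  have := congr_fun h0 (γ.symm i)
  simpa using this

theorem tpDegenerate_comp_iff (γ : Equiv.Perm (Fin 4)) (α β : Fin 4 → K) :
    TPDegenerate (α ∘ γ) (β ∘ γ) ↔ TPDegenerate α β := by
  refine ⟨fun h => ?_, tpDegenerate_comp_of γ⟩
  have h' := tpDegenerate_comp_of γ.symm h
  have e1 : (α ∘ γ) ∘ γ.symm = α := by funext i; simp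
  have e2 : (β ∘ γ) ∘ γ.symm = β := by funext i; simp
  rwa [e1, e2] at h'

theorem tpDegenerate_symm {α β : Fin 4 → K} (h : TPDegenerate α β) : TPDegenerate β α := by
  obtain ⟨v, hv, hT⟩ := h
  exact ⟨v, hv, fun l => by rw [T3_swap₂₃]; exact hT l⟩

/-- The two-row types pull back along a column permutation. -/
theorem twoRowConcl_of_colPerm (γ : Equiv.Perm (Fin 4)) {W W' : Submodule K (Fin 4 × Fin 4 → K)}
    (hmem : ∀ x, x ∈ W ↔ colPermL γ x ∈ W') :
    WColType W' ∨ W2Type W' → WColType W ∨ W2Type W := by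
  have hall : ∀ (x : Fin 4 × Fin 4 → K) (p q : Fin 4),
      (∀ i j : Fin 4, i ≠ p → i ≠ q → x (i, γ j) = 0) ↔
      (∀ i j : Fin 4, i ≠ p → i ≠ q → x (i, j) = 0) := by
    intro x p q
    constructor
    · intro h i j hip hiq
      have := h i (γ.symm j) hip hiq
      simpa using this
    · intro h i j hip hiq
      exact h i (γ j) hip hiq
  rintro (⟨p, q, m, hpq, h⟩ | ⟨p, q, m, m', hpq, hmm, h⟩)
  · refine Or.inl ⟨p, q, γ m, hpq, fun x => ?_⟩
    rw [hmem x, h]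
    simp only [colPermL_apply]
    exact and_congr (hall x p q) Iff.rfl
  · refine Or.inr ⟨p, q, γ m, γ m', hpq, γ.injective.ne hmm, fun x => ?_⟩
    rw [hmem x, h]
    simp only [colPermL_apply]
    exact and_congr (hall x p q) Iff.rfl

/-- The coordinate hyperplane `{v : v m = 0}` of `K⁴`. -/
def colHyp (m : Fin 4) : Submodule K (Fin 4 → K) := LinearMap.ker (LinearMap.proj m)

@[simp] theorem mem_colHyp (m : Fin 4) (v : Fin 4 → K) : v ∈ colHyp (K := K) m ↔ v m = 0 := by
  simp [colHyp]

theorem finrank_colHyp_le (m : Fin 4) : finrank K (colHyp (K := K) m) ≤ 3 := by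
  have hne : colHyp (K := K) m ≠ ⊤ := by
    intro h
    have : (fun _ => (1 : K)) ∈ colHyp (K := K) m := by rw [h]; exact Submodule.mem_top
    simp at this
  have := Submodule.finrank_lt hne
  rw [Module.finrank_fin_fun] at this
  omega

/-- **Case `A = K⁴` in normal position** (the kernel plane on row `1` is `span(e₂, e₃)`):
`W` is `W₂`-type. -/
def CaseTopNorm (K : Type*) [Field K] : Prop :=
  ∀ W : Submodule K (Fin 4 × Fin 4 → K), RowsTwoThreeZero W →
    (∀ y ∈ W, TPDegenerate (row y 0) (row y 1)) →
    (∀ α : Fin 4 → K, ∃ x ∈ W, row x 0 = α) →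
    (∀ x ∈ W, row x 0 = 0 → x (1, 0) = 0 ∧ x (1, 1) = 0) →
    (∀ b : Fin 4 → K, b 0 = 0 → b 1 = 0 → mkL (0, b) ∈ W) →
    W2Type W

/-- **Case both row projections are hyperplanes**: two `3`-dimensional subspaces `A, B ≤ K⁴` with
`P(a, b)` singular for all `a ∈ A`, `b ∈ B` are the SAME coordinate hyperplane. -/
def CaseHyp (K : Type*) [Field K] : Prop :=
  ∀ A B : Submodule K (Fin 4 → K), finrank K A = 3 → finrank K B = 3 →
    (∀ a ∈ A, ∀ b ∈ B, TPDegenerate a b) → ∃ m : Fin 4, A = colHyp m ∧ B = colHyp m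

/-- Fibre step (P1): an element whose row `0` is `(α₀, α₁, α₂, 0)` with `α₀ α₁ α₂ ≠ 0` has
`β₀ = β₁ = 0` (test points `β + (0, 0, y - β₂, 1 - β₃)`, identity `ΔP_fibre3`). -/
theorem fibre_step3 [CharZero K] {W : Submodule K (Fin 4 × Fin 4 → K)}
    (hTP : ∀ y ∈ W, TPDegenerate (row y 0) (row y 1))
    (hC : ∀ b : Fin 4 → K, b 0 = 0 → b 1 = 0 → mkL (0, b) ∈ W)
    {x : Fin 4 × Fin 4 → K} (hx : x ∈ W) (h3 : x (0, 3) = 0) (h0 : x (0, 0) ≠ 0)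
    (h1 : x (0, 1) ≠ 0) (h2 : x (0, 2) ≠ 0) : x (1, 0) = 0 ∧ x (1, 1) = 0 := by
  have key : ∀ y : K, x (0, 0) * x (1, 1) * y + x (0, 1) * x (1, 0) * y +
      x (0, 2) * x (1, 0) * x (1, 1) = 0 := by
    intro y
    set b : Fin 4 → K := ![0, 0, y - x (1, 2), 1 - x (1, 3)] with hb
    have hmem : x + mkL (0, b) ∈ W := W.add_mem hx (hC b (by simp [hb]) (by simp [hb]))
    have hd := ΔP_eq_zero_of_tpDegenerate (hTP _ hmem)
    rw [ΔP_fibre3 _ _ (by simp [h3]) (by simp [hb])] at hd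
    simp only [row_apply, Pi.add_apply, mkL_apply_zero, mkL_apply_one, Pi.zero_apply, add_zero,
      hb] at hd
    simp only [Matrix.cons_val_zero, Matrix.cons_val_one, Matrix.cons_val] at hd
    have h4 : (-4 : K) * x (0, 0) * x (0, 1) * x (0, 2) ≠ 0 := by
      simp [h0, h1, h2]
    have := (mul_eq_zero.mp (by linear_combination hd :
      ((-4 : K) * x (0, 0) * x (0, 1) * x (0, 2)) *
        (x (0, 0) * x (1, 1) * y + x (0, 1) * x (1, 0) * y + x (0, 2) * x (1, 0) * x (1, 1)) = 0))
    exact this.resolve_left h4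
  have k0 := key 0
  have k1 := key 1
  have hprod : x (1, 0) * x (1, 1) = 0 := by
    have : x (0, 2) * (x (1, 0) * x (1, 1)) = 0 := by linear_combination k0
    exact (mul_eq_zero.mp this).resolve_left h2
  have hsum : x (0, 0) * x (1, 1) + x (0, 1) * x (1, 0) = 0 := by
    linear_combination k1 - k0
  rcases mul_eq_zero.mp hprod with h10 | h11
  · refine ⟨h10, ?_⟩
    have : x (0, 0) * x (1, 1) = 0 := by rw [h10, mul_zero, add_zero] at hsum; exact hsum
    exact (mul_eq_zero.mp this).resolve_left h0
  · refine ⟨?_, h11⟩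
    have : x (0, 1) * x (1, 0) = 0 := by rw [h11, mul_zero, zero_add] at hsum; exact hsum
    exact (mul_eq_zero.mp this).resolve_left h1

/-- Fibre step (P2): the same with the roles of columns `2` and `3` exchanged. -/
theorem fibre_step2 [CharZero K] {W : Submodule K (Fin 4 × Fin 4 → K)}
    (hTP : ∀ y ∈ W, TPDegenerate (row y 0) (row y 1))
    (hC : ∀ b : Fin 4 → K, b 0 = 0 → b 1 = 0 → mkL (0, b) ∈ W)
    {x : Fin 4 × Fin 4 → K} (hx : x ∈ W) (h2 : x (0, 2) = 0) (h0 : x (0, 0) ≠ 0)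
    (h1 : x (0, 1) ≠ 0) (h3 : x (0, 3) ≠ 0) : x (1, 0) = 0 ∧ x (1, 1) = 0 := by
  have key : ∀ y : K, x (0, 0) * x (1, 1) * y + x (0, 1) * x (1, 0) * y +
      x (0, 3) * x (1, 0) * x (1, 1) = 0 := by
    intro y
    set b : Fin 4 → K := ![0, 0, 1 - x (1, 2), y - x (1, 3)] with hb
    have hmem : x + mkL (0, b) ∈ W := W.add_mem hx (hC b (by simp [hb]) (by simp [hb]))
    have hd := ΔP_eq_zero_of_tpDegenerate (hTP _ hmem)
    rw [ΔP_fibre2 _ _ (by simp [h2]) (by simp [hb])] at hd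
    simp only [row_apply, Pi.add_apply, mkL_apply_zero, mkL_apply_one, Pi.zero_apply, add_zero,
      hb] at hd
    simp only [Matrix.cons_val_zero, Matrix.cons_val_one, Matrix.cons_val] at hd
    have h4 : (-4 : K) * x (0, 0) * x (0, 1) * x (0, 3) ≠ 0 := by
      simp [h0, h1, h3]
    have := (mul_eq_zero.mp (by linear_combination hd :
      ((-4 : K) * x (0, 0) * x (0, 1) * x (0, 3)) *
        (x (0, 0) * x (1, 1) * y + x (0, 1) * x (1, 0) * y + x (0, 3) * x (1, 0) * x (1, 1)) = 0))
    exact this.resolve_left h4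
  have k0 := key 0
  have k1 := key 1
  have hprod : x (1, 0) * x (1, 1) = 0 := by
    have : x (0, 3) * (x (1, 0) * x (1, 1)) = 0 := by linear_combination k0
    exact (mul_eq_zero.mp this).resolve_left h3
  have hsum : x (0, 0) * x (1, 1) + x (0, 1) * x (1, 0) = 0 := by
    linear_combination k1 - k0
  rcases mul_eq_zero.mp hprod with h10 | h11
  · refine ⟨h10, ?_⟩
    have : x (0, 0) * x (1, 1) = 0 := by rw [h10, mul_zero, add_zero] at hsum; exact hsum
    exact (mul_eq_zero.mp this).resolve_left h0
  · refine ⟨?_, h11⟩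
    have : x (0, 1) * x (1, 0) = 0 := by rw [h11, mul_zero, zero_add] at hsum; exact hsum
    exact (mul_eq_zero.mp this).resolve_left h1

/-- **`CaseTopNorm` (PROVED)**: the graph map into `K⁴ / span(e₂,e₃)` vanishes on the basis
`(1,1,1,0), (1,2,1,0), (1,1,2,0), (1,1,0,1)` (fibre steps), hence everywhere; so
`W = K⁴ ⊕ span(e₂, e₃)` on rows `0, 1`, which is `W₂`-type with `p, q, m, m' = 0, 1, 0, 1`. -/
theorem caseTopNorm [CharZero K] : CaseTopNorm K := by
  intro W hZ hTP hA hB0 hC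
  -- preimages of the basis
  obtain ⟨w1, hw1, hr1⟩ := hA ![1, 1, 1, 0]
  obtain ⟨w2, hw2, hr2⟩ := hA ![1, 2, 1, 0]
  obtain ⟨w3, hw3, hr3⟩ := hA ![1, 1, 2, 0]
  obtain ⟨w4, hw4, hr4⟩ := hA ![1, 1, 0, 1]
  have e1 : ∀ j, w1 (0, j) = (![1, 1, 1, 0] : Fin 4 → K) j := fun j => congr_fun hr1 j
  have e2 : ∀ j, w2 (0, j) = (![1, 2, 1, 0] : Fin 4 → K) j := fun j => congr_fun hr2 j
  have e3 : ∀ j, w3 (0, j) = (![1, 1, 2, 0] : Fin 4 → K) j := fun j => congr_fun hr3 j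
  have e4 : ∀ j, w4 (0, j) = (![1, 1, 0, 1] : Fin 4 → K) j := fun j => congr_fun hr4 j
  have v1 := fibre_step3 hTP hC hw1 (by simp [e1]) (by simp [e1]) (by simp [e1]) (by simp [e1])
  have v2 := fibre_step3 hTP hC hw2 (by simp [e2]) (by simp [e2]) (by simp [e2]) (by simp [e2])
  have v3 := fibre_step3 hTP hC hw3 (by simp [e3]) (by simp [e3]) (by simp [e3]) (by simp [e3])
  have v4 := fibre_step2 hTP hC hw4 (by simp [e4]) (by simp [e4]) (by simp [e4]) (by simp [e4])
  -- (P3): the graph map vanishes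
  have hP3 : ∀ x ∈ W, x (1, 0) = 0 ∧ x (1, 1) = 0 := by
    intro x hx
    set c1 : K := 3 * x (0, 0) - x (0, 1) - x (0, 2) - 2 * x (0, 3) with hc1
    set c2 : K := x (0, 1) - x (0, 0) with hc2
    set c3 : K := x (0, 2) - x (0, 0) + x (0, 3) with hc3
    set c4 : K := x (0, 3) with hc4
    set z := x - (c1 • w1 + c2 • w2 + c3 • w3 + c4 • w4) with hz
    have hzW : z ∈ W := W.sub_mem hx (W.add_mem (W.add_mem (W.add_mem (W.smul_mem c1 hw1)
      (W.smul_mem c2 hw2)) (W.smul_mem c3 hw3)) (W.smul_mem c4 hw4))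
    have hz0 : row z 0 = 0 := by
      funext j
      simp only [row_apply, hz, Pi.sub_apply, Pi.add_apply, Pi.smul_apply, smul_eq_mul, e1, e2, e3,
        e4, Pi.zero_apply]
      fin_cases j <;> simp <;> ring
    have hzv := hB0 z hzW hz0
    have ez : ∀ j, z (1, j) = x (1, j) - (c1 * w1 (1, j) + c2 * w2 (1, j) + c3 * w3 (1, j) +
        c4 * w4 (1, j)) := fun j => by
      simp only [hz, Pi.sub_apply, Pi.add_apply, Pi.smul_apply, smul_eq_mul]
    refine ⟨?_, ?_⟩
    · have := hzv.1
      rw [ez, v1.1, v2.1, v3.1, v4.1] at this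
      simpa using this
    · have := hzv.2
      rw [ez, v1.2, v2.2, v3.2, v4.2] at this
      simpa using this
  -- assemble the `W₂`-type characterisation
  refine ⟨0, 1, 0, 1, zero_ne_one, zero_ne_one, fun x => ⟨fun hx => ?_, fun h => ?_⟩⟩
  · refine ⟨fun i j hi0 hi1 => ?_, (hP3 x hx).1, (hP3 x hx).2⟩
    rcases fin4_of_perm 1 i with rfl | rfl | rfl | rfl
    · exact absurd rfl hi0
    · exact absurd rfl hi1
    · exact (hZ x hx j).1
    · exact (hZ x hx j).2
  · obtain ⟨hrows, h10, h11⟩ := h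
    obtain ⟨w, hw, hrw⟩ := hA (row x 0)
    have hwv := hP3 w hw
    set b : Fin 4 → K := row x 1 - row w 1 with hb
    have hbW : mkL (0, b) ∈ W :=
      hC b (by simp [hb, h10, hwv.1]) (by simp [hb, h11, hwv.2])
    have e : x = w + mkL (0, b) := by
      funext ij
      obtain ⟨i, j⟩ := ij
      fin_cases i
      · have := congr_fun hrw j
        simp only [row_apply] at this
        simp [this]
      · simp [hb]
      · simp [hrows 2 j (by decide) (by decide), (hZ w hw j).1]
      · simp [hrows 3 j (by decide) (by decide), (hZ w hw j).2]
    rw [e]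
    exact W.add_mem hw hbW

/-- Vectors supported on the coordinate pair `{n, n'}` (as a submodule). -/
def pairSupp (n n' : Fin 4) : Submodule K (Fin 4 → K) where
  carrier := {v | ∀ k : Fin 4, k ≠ n → k ≠ n' → v k = 0}
  add_mem' := by
    intro a b ha hb k hk hk'
    simp only [Set.mem_setOf_eq] at ha hb
    simp [ha k hk hk', hb k hk hk']
  zero_mem' := by intro k hk hk'; rfl
  smul_mem' := by
    intro c a ha k hk hk'
    simp only [Set.mem_setOf_eq] at ha
    simp [ha k hk hk']

theorem mem_pairSupp {n n' : Fin 4} {v : Fin 4 → K} :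
    v ∈ pairSupp (K := K) n n' ↔ ∀ k : Fin 4, k ≠ n → k ≠ n' → v k = 0 := Iff.rfl

theorem finrank_pairSupp_le {n n' : Fin 4} (hnn' : n ≠ n') :
    finrank K (pairSupp (K := K) n n') ≤ 2 := by
  set L : (Fin 2 → K) →ₗ[K] (Fin 4 → K) :=
    Fintype.linearCombination K ![(Pi.single n (1 : K) : Fin 4 → K), Pi.single n' (1 : K)] with hL
  have hle : pairSupp (K := K) n n' ≤ LinearMap.range L := by
    intro v hv
    have hv' := mem_pairSupp.mp hv
    refine ⟨![v n, v n'], ?_⟩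
    rw [hL, Fintype.linearCombination_apply, Fin.sum_univ_two]
    funext k
    simp only [Matrix.cons_val_zero, Matrix.cons_val_one, Pi.add_apply, Pi.smul_apply,
      Pi.single_apply, smul_eq_mul, mul_ite, mul_one, mul_zero]
    by_cases hk : k = n
    · subst hk; simp [hnn']
    · by_cases hk' : k = n'
      · subst hk'; simp [hk]
      · simp [hk, hk', hv' k hk hk']
  calc finrank K (pairSupp (K := K) n n') ≤ finrank K (LinearMap.range L) :=
        Submodule.finrank_mono hle
    _ ≤ finrank K (Fin 2 → K) := LinearMap.finrank_range_le L
    _ = 2 := Module.finrank_fin_fun K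

/-- Coordinate permutation of vectors `v ↦ v ∘ γ`. -/
def vecPermL (γ : Equiv.Perm (Fin 4)) : (Fin 4 → K) ≃ₗ[K] (Fin 4 → K) :=
  LinearEquiv.funCongrLeft K K γ

@[simp] theorem vecPermL_apply (γ : Equiv.Perm (Fin 4)) (v : Fin 4 → K) (i : Fin 4) :
    vecPermL γ v i = v (γ i) := rfl

/-- Coordinate sub-case in normal position `m = 0`: if `P(a, b)` is singular for every `a` with
`a₀ = 0` and every `b` in the `3`-space `B`, then `B` is the hyperplane `{b₀ = 0}` (test vectors
`(0,t,1,1), (0,1,t,1), (0,1,1,t)` and the union lemma). -/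
theorem hyp_coord0 [CharZero K] (B : Submodule K (Fin 4 → K)) (hB3 : finrank K B = 3)
    (h : ∀ a : Fin 4 → K, a 0 = 0 → ∀ b ∈ B, TPDegenerate a b) : B ≤ colHyp 0 := by
  have hpt : ∀ b ∈ B, b 0 = 0 ∨ ∃ i : Fin 4, i ≠ 0 ∧ b ∈ pairSupp (K := K) 0 i := by
    intro b hb
    have t023 : b 0 * b 2 * b 3 = 0 := by
      have E1 := ΔP_eq_zero_of_tpDegenerate (h ![0, 1, 1, 1] (by simp) b hb)
      have E2 := ΔP_eq_zero_of_tpDegenerate (h ![0, 2, 1, 1] (by simp) b hb)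
      rw [ΔP_test_0t11] at E1 E2
      exact triple_zero_of_tests E1 E2
    have t013 : b 0 * b 1 * b 3 = 0 := by
      have E1 := ΔP_eq_zero_of_tpDegenerate (h ![0, 1, 1, 1] (by simp) b hb)
      have E2 := ΔP_eq_zero_of_tpDegenerate (h ![0, 1, 2, 1] (by simp) b hb)
      rw [ΔP_test_01t1] at E1 E2
      exact triple_zero_of_tests E1 E2
    have t012 : b 0 * b 1 * b 2 = 0 := by
      have E1 := ΔP_eq_zero_of_tpDegenerate (h ![0, 1, 1, 1] (by simp) b hb)
      have E2 := ΔP_eq_zero_of_tpDegenerate (h ![0, 1, 1, 2] (by simp) b hb)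
      rw [ΔP_test_011t] at E1 E2
      exact triple_zero_of_tests E1 E2
    by_cases hb0 : b 0 = 0
    · exact Or.inl hb0
    · right
      have h23 : b 2 * b 3 = 0 := by
        have : b 0 * (b 2 * b 3) = 0 := by linear_combination t023
        exact (mul_eq_zero.mp this).resolve_left hb0
      have h13 : b 1 * b 3 = 0 := by
        have : b 0 * (b 1 * b 3) = 0 := by linear_combination t013
        exact (mul_eq_zero.mp this).resolve_left hb0
      have h12 : b 1 * b 2 = 0 := by
        have : b 0 * (b 1 * b 2) = 0 := by linear_combination t012
        exact (mul_eq_zero.mp this).resolve_left hb0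
      by_cases hb1 : b 1 = 0
      · by_cases hb2 : b 2 = 0
        · refine ⟨3, by decide, mem_pairSupp.mpr fun k hk0 hk3 => ?_⟩
          fin_cases k
          · exact absurd rfl hk0
          · exact hb1
          · exact hb2
          · exact absurd rfl hk3
        · have hb3 : b 3 = 0 := (mul_eq_zero.mp h23).resolve_left hb2
          refine ⟨2, by decide, mem_pairSupp.mpr fun k hk0 hk2 => ?_⟩
          fin_cases k
          · exact absurd rfl hk0
          · exact hb1
          · exact absurd rfl hk2
          · exact hb3
      · have hb2 : b 2 = 0 := (mul_eq_zero.mp h12).resolve_left hb1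
        have hb3 : b 3 = 0 := (mul_eq_zero.mp h13).resolve_left hb1
        refine ⟨1, by decide, mem_pairSupp.mpr fun k hk0 hk1 => ?_⟩
        fin_cases k
        · exact absurd rfl hk0
        · exact absurd rfl hk1
        · exact hb2
        · exact hb3
  by_contra hnot
  let piece : Fin 4 → Submodule K (Fin 4 → K) :=
    fun i => if i = 0 then colHyp 0 else pairSupp 0 i
  have hne : ∀ i, (piece i).comap B.subtype ≠ ⊤ := by
    intro i htop
    have hall : ∀ b ∈ B, b ∈ piece i := fun b hb => by
      have : (⟨b, hb⟩ : B) ∈ (piece i).comap B.subtype := by rw [htop]; exact Submodule.mem_top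
      exact this
    by_cases hi : i = 0
    · apply hnot
      intro b hb
      have := hall b hb
      simp only [piece, hi, if_true] at this
      exact this
    · have hle : B ≤ pairSupp (K := K) 0 i := fun b hb => by
        have := hall b hb
        simp only [piece, hi, if_false] at this
        exact this
      have h1 := Submodule.finrank_mono hle
      have h2 := finrank_pairSupp_le (K := K) (Ne.symm hi)
      omega
  obtain ⟨x, hx⟩ := Submodule.exists_forall_notMem_of_forall_ne_top _ hne
  rcases hpt x.1 x.2 with h0 | ⟨i, hi, hmem⟩
  · refine hx 0 ?_
    show B.subtype x ∈ piece 0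
    simp only [piece, if_true, Submodule.subtype_apply]
    exact (mem_colHyp 0 _).mpr h0
  · refine hx i ?_
    show B.subtype x ∈ piece i
    simp only [piece, hi, if_false, Submodule.subtype_apply]
    exact hmem

/-- Coordinate sub-case for a general coordinate `m` (transport by the transposition `(0 m)`). -/
theorem hyp_coord [CharZero K] (m : Fin 4) (B : Submodule K (Fin 4 → K)) (hB3 : finrank K B = 3)
    (h : ∀ a : Fin 4 → K, a m = 0 → ∀ b ∈ B, TPDegenerate a b) : B ≤ colHyp m := by
  set γ := Equiv.swap (0 : Fin 4) m with hγ
  set B' := B.map (vecPermL (K := K) γ : (Fin 4 → K) →ₗ[K] (Fin 4 → K)) with hB'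
  have hB3' : finrank K B' = 3 := by rw [hB', LinearEquiv.finrank_map_eq]; exact hB3
  have h' : ∀ a : Fin 4 → K, a 0 = 0 → ∀ b' ∈ B', TPDegenerate a b' := by
    intro a ha b' hb'
    obtain ⟨b, hb, rfl⟩ := Submodule.mem_map.mp hb'
    have e : a = (a ∘ γ) ∘ γ := by funext i; simp [hγ, Equiv.swap_apply_self]
    rw [e]
    exact tpDegenerate_comp_of γ (h (a ∘ γ) (by simp [hγ, ha]) b hb)
  have hle := hyp_coord0 B' hB3' h'
  intro b hb
  have hb' : (vecPermL (K := K) γ : (Fin 4 → K) →ₗ[K] (Fin 4 → K)) b ∈ B' :=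
    Submodule.mem_map_of_mem hb
  have := (mem_colHyp 0 _).mp (hle hb')
  rw [mem_colHyp]
  simpa [hγ] using this

/-- Non-coordinate sub-case, pivot `3` (PROVED): no `b` with all coordinates nonzero has `P(a, b)`
singular for every `a` in a hyperplane `Σ nᵢ aᵢ = 0` with `n₃ ≠ 0` (five explicit test points). -/
theorem noncoord_pivot3 [CharZero K] (n b : Fin 4 → K) (hb : ∀ i, b i ≠ 0) (hn3 : n 3 ≠ 0)
    (h : ∀ a : Fin 4 → K, ∑ i, n i * a i = 0 → TPDegenerate a b) : False := by
  have hP : (b 0 * b 1 * b 2 * b 3) ^ 2 ≠ 0 :=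
    pow_ne_zero 2 (mul_ne_zero (mul_ne_zero (mul_ne_zero (hb 0) (hb 1)) (hb 2)) (hb 3))
  have hc3 : n 3 * b 3 ≠ 0 := mul_ne_zero hn3 (hb 3)
  have h4c : (4 : K) * (n 3 * b 3) ^ 2 ≠ 0 := mul_ne_zero (by norm_num) (pow_ne_zero 2 hc3)
  have E1 := ΔP_eq_zero_of_tpDegenerate (h
    ![b 0 * (n 3 * b 3), -(b 1 * (n 3 * b 3)), 0, -(b 3 * (n 0 * b 0 - n 1 * b 1))]
    (by simp [Fin.sum_univ_four]; ring))
  rw [ΔP_pivot01m] at E1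
  have e01 : n 0 * b 0 = n 1 * b 1 := by
    have h1 := (mul_eq_zero.mp E1).resolve_left hP
    have h2 : (n 0 * b 0 - n 1 * b 1) ^ 2 = 0 := (mul_eq_zero.mp h1).resolve_left h4c
    exact sub_eq_zero.mp ((pow_eq_zero_iff (by norm_num : (2 : ℕ) ≠ 0)).mp h2)
  have E2 := ΔP_eq_zero_of_tpDegenerate (h
    ![b 0 * (n 3 * b 3), 0, -(b 2 * (n 3 * b 3)), -(b 3 * (n 0 * b 0 - n 2 * b 2))]
    (by simp [Fin.sum_univ_four]; ring))
  rw [ΔP_pivot02m] at E2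
  have e02 : n 0 * b 0 = n 2 * b 2 := by
    have h1 := (mul_eq_zero.mp E2).resolve_left hP
    have h2 : (n 0 * b 0 - n 2 * b 2) ^ 2 = 0 := (mul_eq_zero.mp h1).resolve_left h4c
    exact sub_eq_zero.mp ((pow_eq_zero_iff (by norm_num : (2 : ℕ) ≠ 0)).mp h2)
  have E3 := ΔP_eq_zero_of_tpDegenerate (h
    ![b 0 * (n 3 * b 3), b 1 * (n 3 * b 3), 0, -(b 3 * (n 0 * b 0 + n 1 * b 1))]
    (by simp [Fin.sum_univ_four]; ring))
  rw [ΔP_pivot01p] at E3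
  have e03 : n 0 * b 0 = 0 ∨ n 0 * b 0 = n 3 * b 3 := by
    have h1 := (mul_eq_zero.mp E3).resolve_left hP
    -- h1 : 4 c3² (c0 + c1) (2 c3 - c0 - c1) = 0, with c1 = c0
    have h2 : (4 : K) * (n 3 * b 3) ^ 2 * (4 * (n 0 * b 0) * (n 3 * b 3 - n 0 * b 0)) = 0 := by
      linear_combination (exp := 1) h1 - 0 * e01 +
        (4 * (n 3 * b 3) ^ 2) * (2 * (n 3 * b 3) - 3 * (n 0 * b 0) - (n 1 * b 1)) * e01
    have h3 := (mul_eq_zero.mp h2).resolve_left h4c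
    rcases mul_eq_zero.mp h3 with h5 | h5
    · left; exact (mul_eq_zero.mp h5).resolve_left (by norm_num)
    · right; exact (sub_eq_zero.mp h5).symm
  rcases e03 with hc0 | hc0
  · have E4 := ΔP_eq_zero_of_tpDegenerate (h ![b 0, b 1, b 2, 0] (by
      simp [Fin.sum_univ_four]
      linear_combination (exp := 1) 3 * hc0 - e01 - e02))
    rw [ΔP_final1110] at E4
    have := (mul_eq_zero.mp E4).resolve_left hP
    norm_num at this
  · have E5 := ΔP_eq_zero_of_tpDegenerate (h ![b 0, b 1, -b 2, -b 3] (by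
      simp [Fin.sum_univ_four]
      linear_combination (exp := 1) hc0 - e01 + e02))
    rw [ΔP_final11mm] at E5
    have := (mul_eq_zero.mp E5).resolve_left hP
    norm_num at this

/-- **`CaseHyp` (PROVED)**: coordinate sub-case by `hyp_coord` (either side), non-coordinate
sub-case by a normal functional of `A`, a vector of `B` with no zero coordinate (union lemma), a
pivot transport and `noncoord_pivot3`. -/
theorem caseHyp [CharZero K] : CaseHyp K := by
  intro A B hA3 hB3 hTP
  by_cases hcoA : ∃ m, A ≤ colHyp m
  · obtain ⟨m, hAm⟩ := hcoA
    have hAeq : A = colHyp m :=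
      Submodule.eq_of_le_of_finrank_le hAm (by rw [hA3]; exact finrank_colHyp_le m)
    have hBle : B ≤ colHyp m := hyp_coord m B hB3
      (fun a ha b hb => hTP a (by rw [hAeq, mem_colHyp]; exact ha) b hb)
    have hBeq : B = colHyp m :=
      Submodule.eq_of_le_of_finrank_le hBle (by rw [hB3]; exact finrank_colHyp_le m)
    exact ⟨m, hAeq, hBeq⟩
  by_cases hcoB : ∃ m, B ≤ colHyp m
  · obtain ⟨m, hBm⟩ := hcoB
    have hBeq : B = colHyp m :=
      Submodule.eq_of_le_of_finrank_le hBm (by rw [hB3]; exact finrank_colHyp_le m)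
    have hAle : A ≤ colHyp m := hyp_coord m A hA3
      (fun b hb a ha => tpDegenerate_symm (hTP a ha b (by rw [hBeq, mem_colHyp]; exact hb)))
    have hAeq : A = colHyp m :=
      Submodule.eq_of_le_of_finrank_le hAle (by rw [hA3]; exact finrank_colHyp_le m)
    exact ⟨m, hAeq, hBeq⟩
  exfalso
  push Not at hcoA hcoB
  -- a vector of `B` with no zero coordinate
  have hneB : ∀ i : Fin 4, (colHyp (K := K) i).comap B.subtype ≠ ⊤ := by
    intro i htop
    apply hcoB i
    intro b hb
    have : (⟨b, hb⟩ : B) ∈ (colHyp (K := K) i).comap B.subtype := by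
      rw [htop]; exact Submodule.mem_top
    exact this
  obtain ⟨bb, hbb⟩ := Submodule.exists_forall_notMem_of_forall_ne_top _ hneB
  have hb : ∀ i, bb.1 i ≠ 0 := fun i hi => hbb i (by
    show B.subtype bb ∈ colHyp (K := K) i
    exact (mem_colHyp i _).mpr hi)
  -- a normal functional of `A`
  have hAlt : A < ⊤ := by
    refine lt_top_iff_ne_top.mpr fun h => ?_
    have := hA3
    rw [h, finrank_top, Module.finrank_fin_fun] at this
    omega
  obtain ⟨φ, hφ, hAφ⟩ := Submodule.exists_le_ker_of_lt_top A hAlt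
  have hAeq : A = LinearMap.ker φ := by
    refine Submodule.eq_of_le_of_finrank_le hAφ ?_
    have hne : LinearMap.ker φ ≠ ⊤ := by
      intro h
      apply hφ
      refine LinearMap.ext fun v => ?_
      have : (v : Fin 4 → K) ∈ LinearMap.ker φ := by rw [h]; exact Submodule.mem_top
      simpa using this
    have := Submodule.finrank_lt hne
    rw [Module.finrank_fin_fun] at this
    omega
  set n : Fin 4 → K := fun i => φ (fun j => if i = j then 1 else 0) with hn
  have hφa : ∀ a : Fin 4 → K, φ a = ∑ i, n i * a i := by
    intro a
    rw [LinearMap.pi_apply_eq_sum_univ φ a]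
    refine Finset.sum_congr rfl fun i _ => ?_
    rw [smul_eq_mul, hn, mul_comm]
  have hmemA : ∀ a : Fin 4 → K, ∑ i, n i * a i = 0 → a ∈ A := fun a ha => by
    rw [hAeq, LinearMap.mem_ker, hφa]; exact ha
  have hn0 : ∃ k, n k ≠ 0 := by
    by_contra hno
    push Not at hno
    apply hφ
    refine LinearMap.ext fun a => ?_
    rw [hφa]
    simp [hno]
  obtain ⟨k, hk⟩ := hn0
  -- transport the pivot `k ↦ 3`
  set γ := Equiv.swap (3 : Fin 4) k with hγ
  refine noncoord_pivot3 (n ∘ γ) (bb.1 ∘ γ) (fun i => hb (γ i)) (by simpa [hγ] using hk) ?_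
  intro a' ha'
  have hsum : ∑ i, n i * (a' ∘ γ) i = 0 := by
    have e1 : ∑ i, n i * (a' ∘ γ) i = ∑ i, (fun i => n i * (a' ∘ γ) i) (γ i) :=
      (Equiv.sum_comp γ (fun i => n i * (a' ∘ γ) i)).symm
    rw [e1]
    simpa [hγ, Equiv.swap_apply_self, Function.comp] using ha'
  have hT := hTP (a' ∘ γ) (hmemA _ hsum) bb.1 bb.2
  have e : a' = (a' ∘ γ) ∘ γ := by funext i; simp [hγ, Equiv.swap_apply_self]
  rw [e]
  exact tpDegenerate_comp_of γ hT

/-- Rank bookkeeping for two maps out of a `6`-dimensional space whose joint kernel is trivial and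
whose ranges have dimension `≤ 3`: both ranges are `3`-dimensional and the second map is onto its
range already on the kernel of the first. -/
theorem fibre_aux {U : Type*} [AddCommGroup U] [Module K U] [FiniteDimensional K U]
    (f0 f1 : U →ₗ[K] (Fin 4 → K)) (hinj : ∀ z, f0 z = 0 → f1 z = 0 → z = 0)
    (hU : finrank K U = 6) (hA : finrank K (LinearMap.range f0) ≤ 3)
    (hB : finrank K (LinearMap.range f1) ≤ 3) :
    finrank K (LinearMap.range f0) = 3 ∧ finrank K (LinearMap.range f1) = 3 ∧
      ∀ b ∈ LinearMap.range f1, ∃ z, f0 z = 0 ∧ f1 z = b := by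
  set g : LinearMap.ker f0 →ₗ[K] LinearMap.range f1 :=
    (f1 ∘ₗ (LinearMap.ker f0).subtype).codRestrict (LinearMap.range f1)
      (fun z => LinearMap.mem_range_self f1 z.1) with hg
  have hginj : Function.Injective g := by
    refine (injective_iff_map_eq_zero g).mpr fun z hz => ?_
    have h1 : f1 z.1 = 0 := by
      have := congr_arg Subtype.val hz
      simpa [hg] using this
    have h0 : f0 z.1 = 0 := LinearMap.mem_ker.mp z.2
    exact Subtype.ext (hinj z.1 h0 h1)
  have h1 := LinearMap.finrank_range_add_finrank_ker f0
  have h2 := LinearMap.finrank_le_finrank_of_injective hginj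
  rw [hU] at h1
  have hA3 : finrank K (LinearMap.range f0) = 3 := by omega
  have hK3 : finrank K (LinearMap.ker f0) = 3 := by omega
  have hB3 : finrank K (LinearMap.range f1) = 3 := by omega
  refine ⟨hA3, hB3, fun b hb => ?_⟩
  have htop : LinearMap.range g = ⊤ := by
    apply Submodule.eq_top_of_finrank_eq
    rw [LinearMap.finrank_range_of_inj hginj, hK3, hB3]
  have : (⟨b, hb⟩ : LinearMap.range f1) ∈ LinearMap.range g := by rw [htop]; exact Submodule.mem_top
  obtain ⟨z, hz⟩ := LinearMap.mem_range.mp this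
  refine ⟨z.1, LinearMap.mem_ker.mp z.2, ?_⟩
  have := congr_arg Subtype.val hz
  simpa [hg] using this

/-- **Case `A = K⁴`** (general position), reduced to `CaseTopNorm` by the coordinate-plane lemma,
the union lemma and a column transport. -/
theorem caseTop [CharZero K] (hTop : CaseTopNorm K) (W : Submodule K (Fin 4 × Fin 4 → K))
    (h6 : finrank K W = 6) (hZ : RowsTwoThreeZero W)
    (hTP : ∀ y ∈ W, TPDegenerate (row y 0) (row y 1))
    (hA : ∀ α : Fin 4 → K, ∃ x ∈ W, row x 0 = α) : WColType W ∨ W2Type W := by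
  -- (1) Δ(α, b) = 0 for every α and every kernel vector b = row z 1 (z ∈ W, row z 0 = 0)
  have hΔ0 : ∀ z ∈ W, row z 0 = 0 → ∀ α : Fin 4 → K, ΔP α (row z 1) = 0 := by
    intro z hz hz0 α
    obtain ⟨x, hx, hxα⟩ := hA α
    apply ΔP_limit α (row x 1) (row z 1)
    intro t ht
    have hmem : t • x + z ∈ W := W.add_mem (W.smul_mem t hx) hz
    have hd := ΔP_eq_zero_of_tpDegenerate (hTP _ hmem)
    have e0 : row (t • x + z) 0 = t • α := by rw [row_add, row_smul, hxα, hz0, add_zero]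
    have e1 : row (t • x + z) 1 = t • row x 1 + row z 1 := by rw [row_add, row_smul]
    rw [e0, e1, ΔP_smul_left] at hd
    exact (mul_eq_zero.mp hd).resolve_left (pow_ne_zero 4 ht)
  -- (2) pointwise: such a `row z 1` lies in a coordinate `2`-plane
  have hpt : ∀ z ∈ W, row z 0 = 0 → ∃ n n' : Fin 4, n ≠ n' ∧ row z 1 ∈ pairSupp (K := K) n n' := by
    intro z hz hz0
    obtain ⟨n, n', hnn', hk⟩ := exists_pair_support (triples_zero_of_ΔP (row z 1) (hΔ0 z hz hz0))
    exact ⟨n, n', hnn', mem_pairSupp.mpr hk⟩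
  -- (3) the kernel of `row 0` on `W` and its (injective) image under `row 1`
  set f0 : W →ₗ[K] (Fin 4 → K) := (rowL (K := K) 0).domRestrict W with hf0
  set f1 : W →ₗ[K] (Fin 4 → K) := (rowL (K := K) 1).domRestrict W with hf1
  have hf0a : ∀ z : W, f0 z = row z.1 0 := fun z => rfl
  have hf1a : ∀ z : W, f1 z = row z.1 1 := fun z => rfl
  set ψ : LinearMap.ker f0 →ₗ[K] (Fin 4 → K) := f1 ∘ₗ (LinearMap.ker f0).subtype with hψ
  have hψa : ∀ z : LinearMap.ker f0, ψ z = row z.1.1 1 := fun z => rfl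
  have hK0 : finrank K (LinearMap.ker f0) = 2 := by
    have h1 := LinearMap.finrank_range_add_finrank_ker f0
    have hr : LinearMap.range f0 = ⊤ := by
      rw [LinearMap.range_eq_top]
      intro α
      obtain ⟨x, hx, hxα⟩ := hA α
      exact ⟨⟨x, hx⟩, hxα⟩
    rw [hr, finrank_top, Module.finrank_fin_fun] at h1
    have : finrank K W = 6 := h6
    omega
  have hψinj : Function.Injective ψ := by
    intro z z' hzz
    have h0 : row (z - z').1.1 0 = 0 := LinearMap.mem_ker.mp (z - z').2
    have h1 : row (z - z').1.1 1 = 0 := by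
      show row z.1.1 1 - row z'.1.1 1 = 0
      rw [← hψa, ← hψa, hzz, sub_self]
    have := eq_zero_of_rows (z - z').1.1 (hZ _ (z - z').1.2) h0 h1
    exact sub_eq_zero.mp (Subtype.ext (Subtype.ext this))
  have hR2 : finrank K (LinearMap.range ψ) = 2 := by
    rw [LinearMap.finrank_range_of_inj hψinj, hK0]
  -- (4) a uniform pair `{n, n'}` (union lemma on `range ψ`)
  obtain ⟨n, n', hnn', hle⟩ : ∃ n n' : Fin 4, n ≠ n' ∧
      LinearMap.range ψ ≤ pairSupp (K := K) n n' := by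
    by_contra hno
    push Not at hno
    have hne : ∀ pr : {pr : Fin 4 × Fin 4 // pr.1 ≠ pr.2},
        (pairSupp (K := K) pr.1.1 pr.1.2).comap (LinearMap.range ψ).subtype ≠ ⊤ := by
      intro pr htop
      apply hno pr.1.1 pr.1.2 pr.2
      intro b hb
      have : (⟨b, hb⟩ : LinearMap.range ψ) ∈
          (pairSupp (K := K) pr.1.1 pr.1.2).comap (LinearMap.range ψ).subtype := by
        rw [htop]; exact Submodule.mem_top
      exact this
    obtain ⟨bb, hbb⟩ := Submodule.exists_forall_notMem_of_forall_ne_top _ hne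
    obtain ⟨z, hz⟩ := LinearMap.mem_range.mp bb.2
    obtain ⟨n, n', hnn', hk⟩ := hpt z.1.1 z.1.2 (LinearMap.mem_ker.mp z.2)
    refine hbb ⟨(n, n'), hnn'⟩ ?_
    show bb.1 ∈ pairSupp (K := K) n n'
    rw [← hz, hψa]
    exact hk
  -- (5) the plane is full: every `b` supported on `{n, n'}` is a kernel vector
  have heq : LinearMap.range ψ = pairSupp (K := K) n n' :=
    Submodule.eq_of_le_of_finrank_le hle (by rw [hR2]; exact finrank_pairSupp_le hnn')
  have hC : ∀ b : Fin 4 → K, (∀ k : Fin 4, k ≠ n → k ≠ n' → b k = 0) → mkL (0, b) ∈ W := by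
    intro b hb
    have hb' : b ∈ LinearMap.range ψ := by rw [heq]; exact mem_pairSupp.mpr hb
    obtain ⟨z, hz⟩ := LinearMap.mem_range.mp hb'
    have h0 : row z.1.1 0 = 0 := LinearMap.mem_ker.mp z.2
    have h1 : row z.1.1 1 = b := by rw [← hψa]; exact hz
    have := mkL_rows_eq z.1.1 (hZ z.1.1 z.1.2)
    rw [h0, h1] at this
    rw [this]
    exact z.1.2
  have hB0 : ∀ z ∈ W, row z 0 = 0 → ∀ k : Fin 4, k ≠ n → k ≠ n' → z (1, k) = 0 := by
    intro z hz hz0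
    have hmem : row z 1 ∈ LinearMap.range ψ :=
      LinearMap.mem_range.mpr ⟨⟨⟨z, hz⟩, LinearMap.mem_ker.mpr hz0⟩, rfl⟩
    rw [heq] at hmem
    exact mem_pairSupp.mp hmem
  -- (6) column transport `2 ↦ n`, `3 ↦ n'` and the normal-position case
  obtain ⟨γ, hγ2, hγ3⟩ := exists_perm_two_three hnn'
  have hmem := mem_iff_map_equiv (colPermL γ) W
  set W' := W.map (colPermL (K := K) γ : (Fin 4 × Fin 4 → K) →ₗ[K] (Fin 4 × Fin 4 → K)) with hW'
  have hγ0n : γ 0 ≠ n := by rw [← hγ2]; exact fun h => by simpa using γ.injective h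
  have hγ0n' : γ 0 ≠ n' := by rw [← hγ3]; exact fun h => by simpa using γ.injective h
  have hγ1n : γ 1 ≠ n := by rw [← hγ2]; exact fun h => by simpa using γ.injective h
  have hγ1n' : γ 1 ≠ n' := by rw [← hγ3]; exact fun h => by simpa using γ.injective h
  have hZ' : RowsTwoThreeZero W' := by
    intro y hy j
    obtain ⟨x, hx, rfl⟩ := Submodule.mem_map.mp hy
    exact ⟨(hZ x hx (γ j)).1, (hZ x hx (γ j)).2⟩
  have hTP' : ∀ y ∈ W', TPDegenerate (row y 0) (row y 1) := by
    intro y hy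
    obtain ⟨x, hx, rfl⟩ := Submodule.mem_map.mp hy
    exact tpDegenerate_comp_of γ (hTP x hx)
  have hA' : ∀ α : Fin 4 → K, ∃ y ∈ W', row y 0 = α := by
    intro α
    obtain ⟨x, hx, hxα⟩ := hA (α ∘ γ.symm)
    refine ⟨colPermL γ x, Submodule.mem_map_of_mem hx, ?_⟩
    show row x 0 ∘ γ = α
    rw [hxα]; funext j; simp
  have hB0' : ∀ y ∈ W', row y 0 = 0 → y (1, 0) = 0 ∧ y (1, 1) = 0 := by
    intro y hy hy0
    obtain ⟨x, hx, rfl⟩ := Submodule.mem_map.mp hy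
    have hx0 : row x 0 = 0 := by
      funext j
      have := congr_fun hy0 (γ.symm j)
      simpa using this
    exact ⟨hB0 x hx hx0 (γ 0) hγ0n hγ0n', hB0 x hx hx0 (γ 1) hγ1n hγ1n'⟩
  have hC' : ∀ b : Fin 4 → K, b 0 = 0 → b 1 = 0 → mkL (0, b) ∈ W' := by
    intro b hb0 hb1
    have hin : mkL (0, b ∘ γ.symm) ∈ W := by
      apply hC
      intro k hk hk'
      rcases fin4_of_perm γ k with rfl | rfl | rfl | rfl
      · simpa using hb0
      · simpa using hb1
      · exact absurd hγ2 hk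
      · exact absurd hγ3 hk'
    have e : (colPermL (K := K) γ : (Fin 4 × Fin 4 → K) →ₗ[K] (Fin 4 × Fin 4 → K))
        (mkL (0, b ∘ γ.symm)) = mkL (0, b) := by
      funext ij
      obtain ⟨i, j⟩ := ij
      fin_cases i <;> simp
    rw [← e]
    exact Submodule.mem_map_of_mem hin
  exact twoRowConcl_of_colPerm γ hmem (Or.inr (hTop W' hZ' hTP' hA' hB0' hC'))

/-- **5b assembled (kernel-checked case split)**: `A = K⁴` / `B = K⁴` (row swap) / both
projections hyperplanes with `W = A ⊕ B`. -/
theorem twoRowClassify_of [CharZero K] (hTop : CaseTopNorm K) (hHyp : CaseHyp K) :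
    ∀ W : Submodule K (Fin 4 × Fin 4 → K), finrank K W = 6 → RowsTwoThreeZero W →
      (∀ y ∈ W, TPDegenerate (row y 0) (row y 1)) → WColType W ∨ W2Type W := by
  intro W h6 hZ hTP
  by_cases hA : ∀ α : Fin 4 → K, ∃ x ∈ W, row x 0 = α
  · exact caseTop hTop W h6 hZ hTP hA
  by_cases hB : ∀ β : Fin 4 → K, ∃ x ∈ W, row x 1 = β
  · -- swap the two live rows
    have hσ2 : Equiv.swap (0 : Fin 4) 1 2 = 2 := by decide
    have hσ3 : Equiv.swap (0 : Fin 4) 1 3 = 3 := by decide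
    have hσ0 : Equiv.swap (0 : Fin 4) 1 0 = 1 := by decide
    have hσ1 : Equiv.swap (0 : Fin 4) 1 1 = 0 := by decide
    have hmem := mem_iff_map_equiv (rowPermL (Equiv.swap (0 : Fin 4) 1)) W
    set W' := W.map (rowPermL (K := K) (Equiv.swap (0 : Fin 4) 1) :
      (Fin 4 × Fin 4 → K) →ₗ[K] (Fin 4 × Fin 4 → K)) with hW'
    have h6' : finrank K W' = 6 := by rw [hW', LinearEquiv.finrank_map_eq]; exact h6
    have hZ' : RowsTwoThreeZero W' := by
      intro y hy j
      obtain ⟨x, hx, rfl⟩ := Submodule.mem_map.mp hy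
      refine ⟨?_, ?_⟩
      · show x (Equiv.swap (0 : Fin 4) 1 2, j) = 0
        rw [hσ2]; exact (hZ x hx j).1
      · show x (Equiv.swap (0 : Fin 4) 1 3, j) = 0
        rw [hσ3]; exact (hZ x hx j).2
    have hrow : ∀ x : Fin 4 × Fin 4 → K,
        row ((rowPermL (K := K) (Equiv.swap (0 : Fin 4) 1) :
          (Fin 4 × Fin 4 → K) →ₗ[K] (Fin 4 × Fin 4 → K)) x) 0 = row x 1 ∧
        row ((rowPermL (K := K) (Equiv.swap (0 : Fin 4) 1) :
          (Fin 4 × Fin 4 → K) →ₗ[K] (Fin 4 × Fin 4 → K)) x) 1 = row x 0 := by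
      intro x
      refine ⟨funext fun j => ?_, funext fun j => ?_⟩
      · show x (Equiv.swap (0 : Fin 4) 1 0, j) = x (1, j)
        rw [hσ0]
      · show x (Equiv.swap (0 : Fin 4) 1 1, j) = x (0, j)
        rw [hσ1]
    have hTP' : ∀ y ∈ W', TPDegenerate (row y 0) (row y 1) := by
      intro y hy
      obtain ⟨x, hx, rfl⟩ := Submodule.mem_map.mp hy
      rw [(hrow x).1, (hrow x).2]
      exact tpDegenerate_symm (hTP x hx)
    have hA' : ∀ α : Fin 4 → K, ∃ y ∈ W', row y 0 = α := by
      intro α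
      obtain ⟨x, hx, hxα⟩ := hB α
      exact ⟨_, Submodule.mem_map_of_mem hx, by rw [(hrow x).1, hxα]⟩
    exact twoRowConcl_of_rowPerm _ hmem (caseTop hTop W' h6' hZ' hTP' hA')
  · -- both projections are proper: `W = A ⊕ B` with `A, B` hyperplanes
    push Not at hA hB
    obtain ⟨α0, hα0⟩ := hA
    obtain ⟨β0, hβ0⟩ := hB
    haveI : FiniteDimensional K W := inferInstance
    set f0 : W →ₗ[K] (Fin 4 → K) := (rowL (K := K) 0).domRestrict W with hf0
    set f1 : W →ₗ[K] (Fin 4 → K) := (rowL (K := K) 1).domRestrict W with hf1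
    have hf0a : ∀ z : W, f0 z = row z.1 0 := fun z => rfl
    have hf1a : ∀ z : W, f1 z = row z.1 1 := fun z => rfl
    have hinj : ∀ z : W, f0 z = 0 → f1 z = 0 → z = 0 := fun z h0 h1 =>
      Subtype.ext (eq_zero_of_rows z.1 (hZ z.1 z.2) h0 h1)
    have hinj' : ∀ z : W, f1 z = 0 → f0 z = 0 → z = 0 := fun z h1 h0 => hinj z h0 h1
    have hAne : LinearMap.range f0 ≠ ⊤ := by
      intro h
      have : α0 ∈ LinearMap.range f0 := by rw [h]; exact Submodule.mem_top
      obtain ⟨z, hz⟩ := LinearMap.mem_range.mp this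
      exact hα0 z.1 z.2 hz
    have hBne : LinearMap.range f1 ≠ ⊤ := by
      intro h
      have : β0 ∈ LinearMap.range f1 := by rw [h]; exact Submodule.mem_top
      obtain ⟨z, hz⟩ := LinearMap.mem_range.mp this
      exact hβ0 z.1 z.2 hz
    have hAle : finrank K (LinearMap.range f0) ≤ 3 := by
      have := Submodule.finrank_lt hAne
      rw [Module.finrank_fin_fun] at this
      omega
    have hBle : finrank K (LinearMap.range f1) ≤ 3 := by
      have := Submodule.finrank_lt hBne
      rw [Module.finrank_fin_fun] at this
      omega
    have hW6 : finrank K W = 6 := h6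
    obtain ⟨hA3, hB3, hfibB⟩ := fibre_aux f0 f1 hinj hW6 hAle hBle
    obtain ⟨-, -, hfibA⟩ := fibre_aux f1 f0 hinj' hW6 hBle hAle
    set A := LinearMap.range f0 with hAdef
    set B := LinearMap.range f1 with hBdef
    -- every pair `(a, b) ∈ A × B` is realised by an element of `W`
    have hpair : ∀ a ∈ A, ∀ b ∈ B, mkL (a, b) ∈ W := by
      intro a ha b hb
      obtain ⟨za, hza1, hza0⟩ := hfibA a ha
      obtain ⟨zb, hzb0, hzb1⟩ := hfibB b hb
      have hsum : (za + zb).1 ∈ W := (za + zb).2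
      have e : mkL (a, b) = (za + zb).1 := by
        rw [← mkL_rows_eq (za + zb).1 (hZ _ hsum)]
        congr 1
        ext1
        · show a = row (za.1 + zb.1) 0
          rw [row_add]
          change a = f0 za + f0 zb
          rw [hza0, hzb0, add_zero]
        · show b = row (za.1 + zb.1) 1
          rw [row_add]
          change b = f1 za + f1 zb
          rw [hza1, hzb1, zero_add]
      rw [e]; exact hsum
    have hTPAB : ∀ a ∈ A, ∀ b ∈ B, TPDegenerate a b := by
      intro a ha b hb
      have := hTP _ (hpair a ha b hb)
      rwa [row_mkL_zero, row_mkL_one] at this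
    obtain ⟨m, hAm, hBm⟩ := hHyp A B hA3 hB3 hTPAB
    refine Or.inl ⟨0, 1, m, zero_ne_one, fun x => ⟨fun hx => ?_, fun h => ?_⟩⟩
    · have ha : row x 0 ∈ A := LinearMap.mem_range.mpr ⟨⟨x, hx⟩, rfl⟩
      have hb : row x 1 ∈ B := LinearMap.mem_range.mpr ⟨⟨x, hx⟩, rfl⟩
      rw [hAm, mem_colHyp] at ha
      rw [hBm, mem_colHyp] at hb
      refine ⟨fun i j hi0 hi1 => ?_, ha, hb⟩
      rcases fin4_of_perm 1 i with rfl | rfl | rfl | rfl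
      · exact absurd rfl hi0
      · exact absurd rfl hi1
      · exact (hZ x hx j).1
      · exact (hZ x hx j).2
    · obtain ⟨hrows, h0, h1⟩ := h
      have ha : row x 0 ∈ A := by rw [hAm, mem_colHyp]; exact h0
      have hb : row x 1 ∈ B := by rw [hBm, mem_colHyp]; exact h1
      have h23 : ∀ j, x (2, j) = 0 ∧ x (3, j) = 0 := fun j =>
        ⟨hrows 2 j (by decide) (by decide), hrows 3 j (by decide) (by decide)⟩
      rw [← mkL_rows_eq x h23]
      exact hpair _ ha _ hb

/-- **5b `twoRowClassify` (PROVED, rev 3.0)** — the driver applied to the two proved cases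
`caseTopNorm` (graph case in normal position) and `caseHyp` (hyperplane case). -/
theorem twoRowClassify [CharZero K] :
    ∀ W : Submodule K (Fin 4 × Fin 4 → K), finrank K W = 6 → RowsTwoThreeZero W →
      (∀ y ∈ W, TPDegenerate (row y 0) (row y 1)) → WColType W ∨ W2Type W :=
  twoRowClassify_of caseTopNorm caseHyp

/-! ### Leaf 5 assembled -/

/-- **Leaf 5 from 5b** (composition through 5-T and 5a, kernel-checked). -/
theorem twoLineFilter_of [CharZero K]
    (h5b : ∀ W : Submodule K (Fin 4 × Fin 4 → K), finrank K W = 6 → RowsTwoThreeZero W →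
      (∀ y ∈ W, TPDegenerate (row y 0) (row y 1)) → WColType W ∨ W2Type W) :
    ∀ W : Submodule K (Fin 4 × Fin 4 → K), finrank K W = 6 → (TwoZeroRows W ∨ TwoZeroCols W) →
      PerDirSix W → WColType W ∨ W2Type W ∨ WColTypeT W ∨ W2TypeT W := by
  have rows : ∀ W : Submodule K (Fin 4 × Fin 4 → K), finrank K W = 6 → TwoZeroRows W →
      PerDirSix W → WColType W ∨ W2Type W := by
    intro W h6 hR hP
    obtain ⟨p, q, hpq, hz⟩ := hR
    obtain ⟨σ, hσ2, hσ3⟩ := exists_perm_two_three hpq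
    have hmem := mem_iff_map_equiv (rowPermL σ) W
    have hZ' : RowsTwoThreeZero
        (W.map (rowPermL (K := K) σ : (Fin 4 × Fin 4 → K) →ₗ[K] (Fin 4 × Fin 4 → K))) := by
      intro y hy j
      obtain ⟨x, hx, rfl⟩ := Submodule.mem_map.mp hy
      refine ⟨?_, ?_⟩
      · show x (σ 2, j) = 0
        rw [hσ2]; exact (hz x hx j).1
      · show x (σ 3, j) = 0
        rw [hσ3]; exact (hz x hx j).2
    refine twoRowConcl_of_rowPerm σ hmem (h5b _ ?_ hZ'
      (twoRowDegenerate _ hZ' (perDirSix_map_of_eval _ (eval_perPoly_rowPermL σ) hP)))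
    rw [LinearEquiv.finrank_map_eq]; exact h6
  intro W h6 hz hP
  rcases hz with hR | ⟨p, q, hpq, hC⟩
  · rcases rows W h6 hR hP with h | h
    · exact Or.inl h
    · exact Or.inr (Or.inl h)
  · have hmem := mem_iff_map_equiv (transposeL (K := K)) W
    have hR' : TwoZeroRows
        (W.map (transposeL (K := K) : (Fin 4 × Fin 4 → K) →ₗ[K] (Fin 4 × Fin 4 → K))) := by
      refine ⟨p, q, hpq, fun y hy j => ?_⟩
      obtain ⟨x, hx, rfl⟩ := Submodule.mem_map.mp hy
      exact hC x hx j
    have h'' := rows _ (by rw [LinearEquiv.finrank_map_eq]; exact h6) hR'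
      (perDirSix_map_of_eval _ eval_perPoly_transposeL hP)
    rcases twoRowConclT_of_transpose hmem h'' with h | h
    · exact Or.inr (Or.inr (Or.inl h))
    · exact Or.inr (Or.inr (Or.inr h))

/-- **Leaf 5 — TWO-LINE FILTER** (memo §5), PROVED (rev 3.0): transport (5-T), Hessian reduction
(5a) and the algebraic classification `twoRowClassify` (5b); it was `stub_twoLineFilter` up to
rev 2.7.  Sanity: finite-field censuses C11a/b of `sing_six_classification_checks.py`. [folklore] -/
theorem twoLineFilter [CharZero K] :
    ∀ W : Submodule K (Fin 4 × Fin 4 → K), finrank K W = 6 → (TwoZeroRows W ∨ TwoZeroCols W) →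
      PerDirSix W → WColType W ∨ W2Type W ∨ WColTypeT W ∨ W2TypeT W :=
  twoLineFilter_of twoRowClassify

/-! ## Kernel-checked compositions -/

/-- **T6′ — classification of the `6`-dimensional linear subspaces of `Sing Z(per₄)`** from leaves 1–2
(composition; the unconditional instance is `sixDim_classification` below). -/
theorem sixDim_classification_of [CharZero K]
    (h1 : ∀ W : Submodule K (Fin 4 × Fin 4 → K), Sing3 W → 5 ≤ finrank K W →
      InCross W ∨ (∃ i : Fin 4, ∀ x ∈ W, ∀ j : Fin 4, x (i, j) = 0) ∨
        (∃ j : Fin 4, ∀ x ∈ W, ∀ i : Fin 4, x (i, j) = 0))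
    (h2 : ∀ W : Submodule K (Fin 4 × Fin 4 → K), Sing3 W → finrank K W = 6 →
      ((∃ i : Fin 4, ∀ x ∈ W, ∀ j : Fin 4, x (i, j) = 0) ∨
        (∃ j : Fin 4, ∀ x ∈ W, ∀ i : Fin 4, x (i, j) = 0)) →
      InCross W ∨ TwoZeroRows W ∨ TwoZeroCols W ∨
        VLambdaRows W ∨ VGraphRows W ∨ VLambdaCols W ∨ VGraphCols W) :
    ∀ W : Submodule K (Fin 4 × Fin 4 → K), Sing3 W → finrank K W = 6 →
      InCross W ∨ TwoZeroRows W ∨ TwoZeroCols W ∨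
        VLambdaRows W ∨ VGraphRows W ∨ VLambdaCols W ∨ VGraphCols W := by
  intro W hS h6
  rcases h1 W hS (by omega) with hX | hrow | hcol
  · exact Or.inl hX
  · exact h2 W hS h6 (Or.inl hrow)
  · exact h2 W hS h6 (Or.inr hcol)

/-- **THEOREM A (T6′) — PROVED, no hypotheses, no `sorry`** (rev 2.6).  Over a field of
characteristic `0`, every `6`-dimensional linear subspace `W` of `Sing Z(per₄)` (all `3 × 3`
subpermanents vanish on `W`) lies in a cross, or has two identically-zero rows, or two identically-zero
columns, or is one of the exotic one-zero-line families `V_Λ` / `V_gr` (rows or columns).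
`sixDim_classification_of zeroLine zeroLineResidue`; `#print axioms`: `propext`, `Classical.choice`,
`Quot.sound`.  (Not a lower bound: the LIST below still rests on leaves 3–5.) -/
theorem sixDim_classification [CharZero K] :
    ∀ W : Submodule K (Fin 4 × Fin 4 → K), Sing3 W → finrank K W = 6 →
      InCross W ∨ TwoZeroRows W ∨ TwoZeroCols W ∨
        VLambdaRows W ∨ VGraphRows W ∨ VLambdaCols W ∨ VGraphCols W :=
  sixDim_classification_of zeroLine zeroLineResidue

/-- Corollary (T5): a `5`-dimensional `W ⊆ Sing Z(per₄)` already lies in a cross or has a zero line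
(`zeroLine` is stated for `dim ≥ 5`). -/
theorem fiveDim_crossOrZeroLine [CharZero K] (W : Submodule K (Fin 4 × Fin 4 → K)) (hS : Sing3 W)
    (h5 : 5 ≤ finrank K W) :
    InCross W ∨ (∃ i : Fin 4, ∀ x ∈ W, ∀ j : Fin 4, x (i, j) = 0) ∨
      (∃ j : Fin 4, ∀ x ∈ W, ∀ i : Fin 4, x (i, j) = 0) :=
  zeroLine W hS h5

/-- **LIST — the V-side list of cell `(10,6,6)`** from the five leaves: a `6`-dimensional singular `W`
with a per-direction family of `≤ 6` squares is of `V×`-, `W_col`- or `W₂`-type (or transposed). -/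
theorem sixDim_perDir_list_of [CharZero K]
    (h1 : ∀ W : Submodule K (Fin 4 × Fin 4 → K), Sing3 W → 5 ≤ finrank K W →
      InCross W ∨ (∃ i : Fin 4, ∀ x ∈ W, ∀ j : Fin 4, x (i, j) = 0) ∨
        (∃ j : Fin 4, ∀ x ∈ W, ∀ i : Fin 4, x (i, j) = 0))
    (h2 : ∀ W : Submodule K (Fin 4 × Fin 4 → K), Sing3 W → finrank K W = 6 →
      ((∃ i : Fin 4, ∀ x ∈ W, ∀ j : Fin 4, x (i, j) = 0) ∨
        (∃ j : Fin 4, ∀ x ∈ W, ∀ i : Fin 4, x (i, j) = 0)) →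
      InCross W ∨ TwoZeroRows W ∨ TwoZeroCols W ∨
        VLambdaRows W ∨ VGraphRows W ∨ VLambdaCols W ∨ VGraphCols W)
    (h3 : ∀ W : Submodule K (Fin 4 × Fin 4 → K),
      (VLambdaRows W ∨ VGraphRows W ∨ VLambdaCols W ∨ VGraphCols W) → ¬ PerDirSix W)
    (h4 : ∀ W : Submodule K (Fin 4 × Fin 4 → K), finrank K W = 6 → InCross W → PerDirSix W →
      VCrossType W)
    (h5 : ∀ W : Submodule K (Fin 4 × Fin 4 → K), finrank K W = 6 → (TwoZeroRows W ∨ TwoZeroCols W) →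
      PerDirSix W → WColType W ∨ W2Type W ∨ WColTypeT W ∨ W2TypeT W) :
    ∀ W : Submodule K (Fin 4 × Fin 4 → K), Sing3 W → finrank K W = 6 → PerDirSix W →
      VCrossType W ∨ WColType W ∨ W2Type W ∨ WColTypeT W ∨ W2TypeT W := by
  intro W hS h6 hP
  rcases sixDim_classification_of h1 h2 W hS h6 with hX | hR | hC | hE | hE | hE | hE
  · exact Or.inl (h4 W h6 hX hP)
  · exact Or.inr (h5 W h6 (Or.inl hR) hP)
  · exact Or.inr (h5 W h6 (Or.inr hC) hP)
  · exact absurd hP (h3 W (Or.inl hE))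
  · exact absurd hP (h3 W (Or.inr (Or.inl hE)))
  · exact absurd hP (h3 W (Or.inr (Or.inr (Or.inl hE))))
  · exact absurd hP (h3 W (Or.inr (Or.inr (Or.inr hE))))

/-- **LIST, unconditional and `sorry`-free (rev 3.0)**: leaves 1–2 — Theorem A — are proved here
(revs 2.5/2.6), leaves 3–4 are tree theorems of val-width-5674-w2 cited by name (rev 2.7), leaf 5 is
proved here (revs 2.8/3.0).  Axioms: `propext, Classical.choice, Quot.sound`. -/
theorem sixDim_perDir_list [CharZero K] :
    ∀ W : Submodule K (Fin 4 × Fin 4 → K), Sing3 W → finrank K W = 6 → PerDirSix W →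
      VCrossType W ∨ WColType W ∨ W2Type W ∨ WColTypeT W ∨ W2TypeT W :=
  sixDim_perDir_list_of zeroLine zeroLineResidue exoticNoSixSquares
    crossFilter twoLineFilter

end Summit.ValiantsHypothesis.ValiantsHypothesis.Cruxes.SdcSuperquadratic.SingSixClassification

end
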